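import Literature.MathematicalPhysics.QuantumFieldTheory.Balaban1983to89.T4CombSecondRaw
import Literature.MathematicalPhysics.QuantumFieldTheory.Balaban1983to89.T4TrajectoryComparison

/-!
# `T4CombWindowSocket` — the comb lineage's telescoped all-raw window MEETS the NE1′-P1 consumer socket

pv24 one-writer leaf (surge node prover #24, gen 15; self-rows `T4-O3.E-NE1′-OG1′-SOCKET*` (v1, §§1–4) and
`T4-O3.E-NE1′-OG1′-SOCKET-EPS*` (v1.1, §5) of the cell's T4-DAG §8 Q24(a); v1.2 = gen 16's self-row
`T4-O3.E-NE1′-OG1′-DICT-RED*`, the APPEND-ONLY §6 — §§1–5 unchanged).  A KERNEL LIAISON of two LANDED files,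
both used BY NAME and neither modified:
* PRODUCER — this lineage's `T4CombSecondRaw` v1.2 (pv24-g14, p188928) §7: `windowData_comb_second_allRaw_tel` (window
  data of the comb-gauge block deviation of a unitary-like pair from TWELVE RAW BLOCK SUPS, telescoped Hölder entry)
  and `winN_printWin_second_allRaw_tel_le` (its `θ`-uniform rate under the printed-type dictionary with a CONSTANT
  comb count — reading (A));
* CONSUMER — t4-ne1p-p1's `T4TrajectoryComparison` §9 (v1.2; code unchanged through v1.8, p189630):
  `transportsFrom_of_window` / `latticeTrajectory_budget_window_strict`, whose hypothesis `hlin` asks, per generation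
  `(b, k′)` and scale `k`, for an attaining pair with a unitary-like block gauge and window data `b_w` at the
  generation-relative rate `N_κ(b_w) ≤ c_δ·ψ^{k−k′}` and whose header says that how such data arise is «pv24 … BY
  NAME, upstream of this hypothesis».  Nobody had composed the two; this file does, and nothing else.

VALUE = typed skeleton + kernel certificate of ONE EDGE of the T4-DAG (producer → consumer socket), NOT summit
progress.  The estimate NE1′ is OPEN.  NOTHING about Bałaban's configurations, actions, propagators or expectations is
proved here: every statement is real arithmetic on abstract letters ([arith]), elementary normed-ring algebra on an
abstract lattice configuration pair ([folklore]), or the cell's reading of printed scale powers ([cell reading]).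

PRINTED COPY (the two printed FORMATS this file's currency is read against; both quotations are certified COPY in the
lineage's landed headers and are re-quoted from there, NOT re-read for this file):
* [Balaban1987RG1] (3.31) p. 276 «|𝐀|, |∇^η𝐀|, ‖𝐀‖_{1,β} < α₂ on □₀» — the small-field window of the inductive
  representation: THREE slots, ONE bound `α₂` (cert COPY: `T4TrajectoryComparison` §9 header; record
  `t4/T4-EST-NE1p-P1.md` §1 (L2); `T4CombHolderWindow.Win`).
* [Balaban1985RegularSpaces] (1.36) p. 82 "|A| < B₁(α₀+α₁)(L^jη)^{−1}, |∇^η_{U₀}A| < B₁(α₀+α₁)(L^jη)^{−2},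
  ‖A‖_{1,β} < B₂(β₀)(α₀+α₁)(L^jη)^{−2−β}" for `U₁ = e^{iηA}` — the scale powers of the three slots (cert COPY:
  `T4CombHolderWindow.printWin`).  Which letters of the lineage's rate dictionary are printed sups, which are DERIVED
  (Hölder-type rate `θ^{2+β}`), and which are not printed at all is the located audit `t4/T4-EST-OG1p-D3.md` v1.2 §2 —
  cited, NOT re-adjudicated here; the printed exponent range is «β ≦ β₀ < 1» ((1.36), loc. cit.) / «for
  0 ≦ β ≦ β₀ < 1» ([Balaban1987RG1] (3.31), loc. cit.; the cell's located row for this range is GAPS G-B12s-11), and the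
  endpoint «β₀ = 1» printed in [Balaban1985Variational]
  Thm 1 (9) p. 279 carries the lineage label «sourceless at β₀ = 1, derived for β₀ < 1» (GAPS C-B11-F3b / C-B8-18;
  record (C6)) — below, `β ∈ [0, 1]` is an abstract real parameter and `β = 1` is arithmetic only.

WHAT THIS FILE DOES.
* §1 [arith] THE UNIT-WEIGHT RATE.  The consumer's window norm `N_κ` with UNIT weights `κ = (1, 1, 1)` (`unitWin`) IS
  the printed equal-bound format (3.31): `N_{(1,1,1)}(b) ≤ w ⟺ b₀ ≤ w ∧ b₁ ≤ w ∧ b₂ ≤ w`.  Under reading (A)'s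
  printed-type dictionary at parameter `θ` (`DictA θ c β C ℓ`: `C ≤ c`, `s, q₀, q₁, γU, γU₁ ≤ cθ²`, `τ₀, τ₁ ≤ cθ`,
  `γ₀, γ₁, γγU, γγP, γγ₁ ≤ cθ^{2+β}`; `0 < θ ≤ 1 ≤ c`, `0 ≤ β ≤ 1`) and a block side `L ≤ Λ`, `1 ≤ Λ`, the
  TELESCOPED all-raw window triple `telWin C L β ℓ = (C·s, G_raw + C·s·γU, L^{1−β}·σ)` of `T4CombSecondRaw` §7
  satisfies `N_{(1,1,1)}(telWin) ≤ sockConst c Λ · θ²`, `sockConst c Λ = 22c⁴ + Λ·73·(118c⁵)⁵`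
  (`winN_unit_telWin_le`: the gradient and Hölder slots from `winN_printWin_second_allRaw_tel_le` BY NAME with
  `θ^{2+β} ≤ θ²` and `L^{1−β} ≤ Λ`; the sup slot re-bounded at `θ²` directly, `C·s ≤ c·cθ²`).  Constants not optimised.
* §2 [folklore] THE BUNDLED PRODUCER.  `Letters` (the twelve raw letters), `Letters.Nonneg`, `RawSups L z U₀ U₁ ℓ`
  (the hypotheses of `T4CombSecondRaw.windowData_comb_second_allRaw_tel` VERBATIM, as named fields) and
  `windowData_telWin : RawSups L z U₀ U₁ ℓ → WindowData L z β (blockDev L z (combGauge U₀ U₁ z) U₀ U₁)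
  (telWin ((d−1)(L−1)) L β ℓ)` (`β ≤ 1`, `0 ≤ (d−1)(L−1)`) — that theorem BY NAME, its `G_raw`/`γE_raw` read through
  the definitional `T4CombSecondDifference.gradRaw_eq_gradPoly` / `devGradRaw_eq_devGradPoly`.
* §3 [folklore] THE SOCKET.  `transportsFrom_of_combRaw`: per generation `(b, k′)` a `BlockRel`-invariant carried
  function with a birth slice along UNIT-WEIGHT window directions of its block (radius `r > 0`, window
  `w ≥ sockConst c Λ`), block sides `Lg b k′ ≤ Λ` with `0 ≤ (d−1)(Lg b k′−1) ≤ c` (reading (A) as LOCATED BINDERS,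
  cf. GAPS G-ne1p1-8), a scale ratio `0 < ϑ ≤ 1`, and — for `j ≤ k′ ≤ k ≤ K` under the history `RanBelow Gate k` — the
  size `lin b k′ k` attained up to every `ε > 0` by the response to a unitary-like pair, base in `𝒦 b k′`, whose twelve
  raw block sups obey the dictionary AT `θ = ϑ^{k−k′}` ⟹ `TransportsFrom (4·sockConst c Λ/r) (ϑ²) Gate`
  (= `T4TrajectoryComparison.transportsFrom_of_window` ∘ §2 ∘ §1 with `c_δ = sockConst c Λ`, `ψ = ϑ²`: the rate
  `θ² = (ϑ²)^{k−k′}` is the consumer's `ψ = L⁻²` per order of record `t4/T4-EST-NE1p-P1.md` §0 (I4′) when `ϑ = L⁻¹`).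
  `latticeTrajectory_budget_combRaw_strict`: the same feed under the returned gate `(TOB-k) ∧ H` composed with
  `T4TrajectoryComparison.Trajectory.sizeBound_cubeBudget_of_trajectory_strict` exactly as the consumer's
  `latticeTrajectory_budget_window_strict` composes `transportsFrom_of_window` — the K-uniform budget with the comb
  lineage's producer plugged in.
* §4 [folklore] NON-VACUITY.  The flat pair `U₀ = U₁ ≡ 1` over `ℝ` has `RawSups` with all twelve letters `0`
  (`rawSups_flat`; the comb gauge is trivial, `T4RelativeCombGradient.combGauge_self`), the zero letters obey `DictA`
  for any `0 < θ`, `0 ≤ c` with `C ≤ c` (`dictA_zero`), and `unitWin.Pos`.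
* §5 [arith] (v1.1, same seat) THE SMALL-FIELD PARAMETER.  With `1 ≤ c` the socket of §3 asks for a window
  `w ≥ sockConst c Λ ≥ 22` in ABSOLUTE letter units («`≥ 22`» understates: already `sockConst 1 1 = 22 + 73·118⁵ ≈
  1.67·10¹²` — the constants are not optimised anywhere in the lineage), while the printed window (3.31) is `α₂`-small
  and the three slots
  of (1.36) share ONE small factor (`B₁(α₀+α₁)`, `B₂(β₀)(α₀+α₁)`) in front of the scale powers.  §5 carries that
  factor as a parameter `0 < ε ≤ 1` of the dictionary (`DictE θ ε c β C ℓ`: letters `≤ ε·`(reading (A)'s bounds);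
  `DictE θ 1 = DictA θ`, `dictE_one_iff`) and proves the slot polynomials `ε`-HOMOGENEOUS FROM BELOW — every monomial of
  `C·s`, `G_raw + C·s·γU`, `σ` has degree `≥ 1` in the letters with a nonnegative coefficient, so scaling the letters
  by `ε` scales each slot by at most `ε` (`telWin_scale_le`, bottom-up through `gaugeStep`, `gaugeHess`,
  `devHessPoly`, `gradPoly`, `devGradPoly`, `mapGrad`, `mapHess`, `devHess`, `secondSrc`, `secondFoot`, `secondW`,
  `secondDev`) ⟹ `N_{(1,1,1)}(telWin) ≤ ε·sockConst c Λ·θ²` (`winN_unit_telWin_le_eps`) ⟹ the socket and the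
  K-uniform budget with `c_δ = ε·sockConst c Λ` under the window hypothesis `ε·sockConst c Λ ≤ w`
  (`transportsFrom_of_combRaw_eps`, `latticeTrajectory_budget_combRaw_eps_strict`); non-vacuity `dictE_zero` + the
  flat pair.  The smallness `ε ≤ w / sockConst c Λ` is a HYPOTHESIS on the feed (FORMAT of «α₀, α₁ small w.r.t. α₂»),
  NOT asserted for Bałaban's configurations.
* §6 [folklore]+[arith] (v1.2, gen 16) LETTER REDUCTION — THE UNIT-WEIGHT SOCKET FROM SEVEN RAW LETTERS AT INTEGER
  RATES.  Of the twelve letters, five are lattice differences of ORDER ≥ 1 of plaquette data or of order 2 of bond data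
  (`γ₀, γ₁` plain plaquette gradients, `γγU` bond second differences, `γγP, γγ₁` plaquette second differences) — the
  rows 8–12 that the located audit `t4/T4-EST-OG1p-D3.md` v1.2 §2 grades NOT PRINTED (its census: rows 1–7 and 13
  PRINTED-TYPE / DERIVED, rows 8–12 not printed; cited, not re-adjudicated).  §6 removes them from the socket's feed:
  (a) [folklore] on a block, for a unitary-like configuration, the plain plaquette gradient is `≤ 4·`(plain bond
  gradient sup), the bond second difference `≤ 2·`, the plaquette second difference `≤ 8·` (`plaqGrad_le_of_bondGrad`,
  `bondHess_le_of_bondGrad`, `plaqHess_le_of_bondGrad` — a difference of two based plaquette words is bounded by its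
  four bond differences, `norm_plaq_sub_plaq_le`, and every corner needed lies between the extreme corners of the
  hypothesis, `inBlock_box₃/₄` from `T4CombSecondRaw.inBlock_of_le_of_le`), so SEVEN raw block sups `RawSups₇`
  (`RawSups` with the five fields deleted, the other nine VERBATIM) give the twelve, `RawSups₇.lift : RawSups₇ L z U₀
  U₁ ℓ → RawSups L z U₀ U₁ ℓ.lift` with `ℓ.lift = (s, q₀, q₁, τ₀, τ₁, γU, γU₁, 4γU, 4γU₁, 2γU, 8γU, 8γU₁)`;
  (b) [arith] the unit-weight rate of §1 needs reading (A)'s dictionary only at RATE exponent `0` — `DictA θ c 0 C ℓ`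
  (all twelve letters at the INTEGER rates `θ`, `θ²`) already gives `N_{(1,1,1)}(telWin C L β ℓ) ≤ sockConst c Λ·θ²`
  for every window exponent `β ∈ [0, 1]` (`winN_unit_telWin_le_zero` = `T4CombSecondRaw.gradPoly_le_rateA` /
  `secondDev_allRaw_le_rateA` BY NAME instantiated at their `β := 0`, `L^{1−β} ≤ Λ`; `DictA.exponent_zero`:
  `DictA θ c β ⟹ DictA θ c 0` for `θ ≤ 1`, so §1 is the special case), because in reading (A) the comb count is a
  constant and the telescoped Hölder entry pays only `L^{1−β} ≤ Λ`; hence the SEVEN-LETTER INTEGER-RATE dictionary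
  `Dict₇ θ c C ℓ` (`C ≤ c`; `s, q₀, q₁, γU, γU₁ ≤ cθ²`; `τ₀, τ₁ ≤ cθ` — rows 1–7 + 13 only, no Hölder-type rate, no
  letter of order ≥ 2) lifts to `DictA θ (8c) 0 C ℓ.lift` (`Dict₇.lift`) and `N_{(1,1,1)}(telWin C L β ℓ.lift) ≤
  sockConst (8c) Λ·θ²` (`winN_unit_telWin₇_le`); (c) with the small-field parameter of §5: `Dict₇E θ ε c C ℓ`,
  `winN_unit_telWin₇_le_eps` (`≤ ε·sockConst (8c) Λ·θ²`, via `Letters₇.lift_scale` and §5's `telWin_scale_le`),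
  the producer `exists_windowData_unit₇_eps` and the sockets `transportsFrom_of_combRaw₇_eps` /
  `latticeTrajectory_budget_combRaw₇_eps_strict` — §5's two theorems with the feed asking, per attaining pair, only
  for `RawSups₇` + `Dict₇E (ϑ^{k−k′}) ε c ((d−1)(Lg b k′−1)) ℓ`, conclusion `TransportsFrom (4·(ε·sockConst (8c)
  Λ)/r) (ϑ²) Gate` (again `T4TrajectoryComparison.transportsFrom_of_window` BY NAME); (d) non-vacuity
  (`rawSups₇_flat`, `dict₇E_zero`, an end-to-end `example`) and the projections `RawSups.drop`, `DictA.drop`,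
  `DictE.drop`: the seven-letter feed asks LESS of each pair than §3/§5 (price: `sockConst (8c) Λ` for
  `sockConst c Λ`).  CENSUS EFFECT (record D3 §2, by pointer): the unit-weight comb socket of reading (A) consumes
  only the letters of rows 1–7 + 13; the five not-printed letters are DERIVED in the kernel from `γU, γU₁` at rate
  `θ²` (row 11's «θ² (trivial)» substitute, which §6 shows suffices for THIS window).  The gauge caveat of the record's
  (u5) is untouched: `τ₀, τ₁, γU, γU₁` are letters of a PRESENTATION of the pair (bond variables in a small gauge of
  the (3.35) type), not gauge-invariant quantities.

HONEST SCOPE.  (i) Reading (A) (the comb's block side is the FIXED integer `L` of the construction, one tree per block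
of side `L` on each scale as in the printed axial gauge [Balaban1985RegularSpaces] (1.15) p. 78, so the comb count
`C = (d−1)(L−1)` is a constant and `θ = L^{−(k−k′)}` an independent small parameter) versus reading (B) (one comb over
a block of side `L^{k−k′}`, only `Cθ ≤ c`, under which the gradient slot FAILS, `T4CombSecondRaw.gradSlot_not_uniform_
readingB`) is a CELL DECISION recorded as DIVERGENCE D-pv24.6/6a; this file TYPES reading (A) as the located binders
`hL`, `hCnn`, `hCc` of §3 and decides nothing.  (ii) The window of `T4CombHolderWindow` is built from PLAIN lattice
differences, axis-parallel Hölder pairs, no parallel transport (HONEST SCOPE of that file) — the printed (3.31)/(1.36)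
slots are COVARIANT; the format is matched, the covariant dictionary is not supplied (lineage residual (S2)).  (iii) The
feed `hfeed` of §3 asks for the dictionary at `θ = ϑ^{k−k′}` on the attaining pair of history depth `k − k′`: that such
pairs exist for Bałaban's small-field configurations is (I4′)-type INPUT of the consumer (record `t4/T4-EST-NE1p-P1.md`
§4), owned elsewhere, not asserted; likewise (§5) that their letters carry a common small factor `ε` with
`ε·sockConst c Λ ≤ w`.  (iv) `β = 1` and `L = 0` are admitted by the arithmetic and carry no claim.  (v) (§6) The
letter reduction changes WHICH block sups the feed asks for, not WHAT is asserted of print: that Bałaban's small-field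
pairs, presented in a (3.35)-type gauge on the block, obey `Dict₇E` at `θ = ϑ^{k−k′}` with a common `ε` is the same
(I4′)-type INPUT as in (iii), owned by the consumer's record and NOT asserted here; the covariant format (S2) and the
patching (S3) residuals of the lineage are untouched by §6.

LABELS.  [folklore] = elementary; [arith] = real arithmetic on abstract letters; [cell reading] = the cell's reading of
printed scale powers into bond-variable units (`T4CombHolderWindow.printWin` docstring), not print.  No `[cite: …]`
tag is attached to any declaration of this file: no declaration transcribes a printed statement.
-/

namespace Literature.MathematicalPhysics.QuantumFieldTheory.Balaban1983to89.T4CombWindowSocket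

open Finset
open Literature.MathematicalPhysics.QuantumFieldTheory.Balaban1983to89.T4TermFormat
open Literature.MathematicalPhysics.QuantumFieldTheory.Balaban1983to89.T4TermFormat.Booking
open Literature.MathematicalPhysics.QuantumFieldTheory.Balaban1983to89.T4GatedBooking
open Literature.MathematicalPhysics.QuantumFieldTheory.Balaban1983to89.T4PreservedUnderT
open B8Lemma1Lattice (e InBlock)
open T4RelativeLadder (UnitaryLike)
open T4RelativeComb (Cfg gaugeAct plaq combGauge unitaryLike_combGauge PlaqSup)
open T4RelativeCombGradient (combGauge_self)
open T4CombHolderWindow (Win winN WindowData blockDev wMove wN printWin gradRaw winN_le_iff winN_printWin_le_iff)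
open T4CombSecondDifference (secondDev devGradRaw gradPoly devGradPoly gradRaw_eq_gradPoly devGradRaw_eq_devGradPoly)
open T4CombSecondRaw (devHessPoly windowData_comb_second_allRaw_tel winN_printWin_second_allRaw_tel_le
  rpow_printed_le_sq rpow_one_sub_le_self)
open T4BlockTransport (Fld val BlockRel)
open T4BirthChartTransport (GaugeInvariant BirthSlice)
open T4TrajectoryComparison (Trajectory RanBelow transportsFrom_of_window)

variable {R : Type*} [NormedRing R] {d : ℕ}

/-- [folklore] Sites of the `d`-dimensional lattice (= `B8Lemma1Lattice.Site`). -/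
abbrev Site (d : ℕ) : Type := Fin d → ℤ

/-! ## §1  [arith] The unit-weight window norm and the rate of the telescoped all-raw window under reading (A) -/

section UnitRate

/-- [folklore] (cell reading of the FORMAT (3.31): three slots, one bound) THE UNIT WEIGHTS `κ = (1, 1, 1)`: with them
`T4CombHolderWindow.winN` is `max(b₀, b₁, b₂)` and the window condition `N_κ(b) ≤ w` reads `b₀, b₁, b₂ ≤ w` — the shape
«|𝐀|, |∇^η𝐀|, ‖𝐀‖_{1,β} < α₂» with `w` in the rôle of `α₂`. -/
def unitWin : Win := ⟨1, 1, 1⟩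

/-- [folklore] The unit weights are positive. -/
theorem unitWin_pos : unitWin.Pos := ⟨one_pos, one_pos, one_pos⟩

/-- [folklore] With unit weights the window condition is slot-wise `≤ w`. -/
theorem winN_unitWin_le_iff {b : Win} {w : ℝ} : winN unitWin b ≤ w ↔ b.sup ≤ w ∧ b.grad ≤ w ∧ b.hol ≤ w := by
  rw [winN_le_iff unitWin_pos]; simp only [unitWin, mul_one]

/-- [folklore] THE TWELVE RAW LETTERS of a configuration pair on a block (the real inputs of
`T4CombSecondRaw.windowData_comb_second_allRaw(_tel)`): gauge-fixed relative plaquette deviation `s`, curvatures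
`q₀, q₁`, bond deviations `τ₀, τ₁`, plain bond gradients `γU, γU₁`, plain plaquette gradients `γ₀, γ₁`, plain second
differences of base bonds `γγU`, of base plaquettes `γγP`, of the second configuration's plaquettes `γγ₁`. -/
@[ext] structure Letters where
  /-- gauge-fixed relative plaquette deviation sup -/
  s : ℝ
  /-- curvature sup of `U₀` -/
  q₀ : ℝ
  /-- curvature sup of `U₁` -/
  q₁ : ℝ
  /-- bond deviation sup of `U₀` -/
  τ₀ : ℝ
  /-- bond deviation sup of `U₁` -/
  τ₁ : ℝ
  /-- plain bond gradient sup of `U₀` -/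
  γU : ℝ
  /-- plain bond gradient sup of `U₁` -/
  γU₁ : ℝ
  /-- plain plaquette gradient sup of `U₀` -/
  γ₀ : ℝ
  /-- plain plaquette gradient sup of `U₁` -/
  γ₁ : ℝ
  /-- plain bond second-difference sup of `U₀` -/
  γγU : ℝ
  /-- plain plaquette second-difference sup of `U₀` -/
  γγP : ℝ
  /-- plain plaquette second-difference sup of `U₁` -/
  γγ₁ : ℝ

/-- [folklore] All twelve letters nonnegative (the sign hypotheses of the producer). -/
structure Letters.Nonneg (ℓ : Letters) : Prop where
  hs : 0 ≤ ℓ.s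
  hq₀ : 0 ≤ ℓ.q₀
  hq₁ : 0 ≤ ℓ.q₁
  hτ₀ : 0 ≤ ℓ.τ₀
  hτ₁ : 0 ≤ ℓ.τ₁
  hγU : 0 ≤ ℓ.γU
  hγU₁ : 0 ≤ ℓ.γU₁
  hγ₀ : 0 ≤ ℓ.γ₀
  hγ₁ : 0 ≤ ℓ.γ₁
  hγγU : 0 ≤ ℓ.γγU
  hγγP : 0 ≤ ℓ.γγP
  hγγ₁ : 0 ≤ ℓ.γγ₁

/-- [folklore] (cell reading, NOT print) READING (A)'s PRINTED-TYPE DICTIONARY at parameter `θ` with constant `c`, Hölder exponent `β` and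
comb count `C` (the rate hypotheses of `T4CombSecondRaw.winN_printWin_second_allRaw_tel_le` VERBATIM, as named fields):
a CONSTANT count `C ≤ c`; `s, q₀, q₁, γU, γU₁ ≤ cθ²`; `τ₀, τ₁ ≤ cθ`; the plaquette gradients and all second
differences at the Hölder-DERIVED rate `γ₀, γ₁, γγU, γγP, γγ₁ ≤ cθ^{2+β}`.  Per-letter printed status: record
`t4/T4-EST-OG1p-D3.md` v1.2 §2 (not re-adjudicated).  NOT asserted for Bałaban's configurations. -/
structure DictA (θ c β C : ℝ) (ℓ : Letters) : Prop where
  count : C ≤ c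
  dev : ℓ.s ≤ c * θ ^ 2
  curv₀ : ℓ.q₀ ≤ c * θ ^ 2
  curv₁ : ℓ.q₁ ≤ c * θ ^ 2
  bond₀ : ℓ.τ₀ ≤ c * θ
  bond₁ : ℓ.τ₁ ≤ c * θ
  gradU₀ : ℓ.γU ≤ c * θ ^ 2
  gradU₁ : ℓ.γU₁ ≤ c * θ ^ 2
  gradP₀ : ℓ.γ₀ ≤ c * θ ^ (2 + β)
  gradP₁ : ℓ.γ₁ ≤ c * θ ^ (2 + β)
  hessU₀ : ℓ.γγU ≤ c * θ ^ (2 + β)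
  hessP₀ : ℓ.γγP ≤ c * θ ^ (2 + β)
  hessP₁ : ℓ.γγ₁ ≤ c * θ ^ (2 + β)

/-- [folklore] THE TELESCOPED ALL-RAW WINDOW TRIPLE of `T4CombSecondRaw.windowData_comb_second_allRaw_tel` as a function
of the comb count `C`, the block side `L`, the exponent `β` and the twelve letters:
`(C·s, G_raw + C·s·γU, L^{1−β}·σ)` with `G_raw = gradPoly C …`, `σ = secondDev C s q₀ τ₀ G_raw γU γ₀ γE_raw γγU γγP γγE_raw`,
`γE_raw = devGradPoly C …`, `γγE_raw = devHessPoly C …`. -/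
noncomputable def telWin (C : ℝ) (L : ℕ) (β : ℝ) (ℓ : Letters) : Win :=
  ⟨C * ℓ.s,
    gradPoly C ℓ.s ℓ.q₀ ℓ.q₁ ℓ.τ₀ ℓ.τ₁ ℓ.γU ℓ.γ₀ ℓ.γ₁ + C * ℓ.s * ℓ.γU,
    (L : ℝ) ^ (1 - β) *
      secondDev C ℓ.s ℓ.q₀ ℓ.τ₀ (gradPoly C ℓ.s ℓ.q₀ ℓ.q₁ ℓ.τ₀ ℓ.τ₁ ℓ.γU ℓ.γ₀ ℓ.γ₁) ℓ.γU ℓ.γ₀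
        (devGradPoly C ℓ.s ℓ.q₁ ℓ.τ₀ ℓ.τ₁ ℓ.γ₀ ℓ.γ₁) ℓ.γγU ℓ.γγP
        (devHessPoly C ℓ.s ℓ.q₁ ℓ.τ₀ ℓ.τ₁ (gradPoly C ℓ.s ℓ.q₀ ℓ.q₁ ℓ.τ₀ ℓ.τ₁ ℓ.γU ℓ.γ₀ ℓ.γ₁) ℓ.γU ℓ.γU₁ ℓ.γ₁
          ℓ.γγP ℓ.γγ₁)⟩

/-- [folklore] (arith) THE SOCKET CONSTANT `sockConst c Λ = 22c⁴ + Λ·73·(118c⁵)⁵` (the constant of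
`T4CombSecondRaw.winN_printWin_second_allRaw_tel_le` with its factor `L^{1−β}` replaced by a bound `Λ` of the block
side).  Constants not optimised. -/
noncomputable def sockConst (c Λ : ℝ) : ℝ := 22 * c ^ 4 + Λ * (73 * (118 * c ^ 5) ^ 5)

/-- [folklore] (arith) `0 ≤ sockConst c Λ` for `0 ≤ c`, `0 ≤ Λ`. -/
theorem sockConst_nonneg {c Λ : ℝ} (hc : 0 ≤ c) (hΛ : 0 ≤ Λ) : 0 ≤ sockConst c Λ := by
  unfold sockConst; positivity

/-- [folklore] (arith) The telescoping factor under a bound of the block side: `L ≤ Λ`, `1 ≤ Λ`, `0 ≤ β ≤ 1` ⟹ `L^{1−β} ≤ Λ`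
(`L ≥ 1`: `L^{1−β} ≤ L`, `T4CombSecondRaw.rpow_one_sub_le_self`; `L < 1`: `L^{1−β} ≤ 1`). -/
theorem rpow_one_sub_le_of_le {L : ℕ} {Λ β : ℝ} (hL : (L : ℝ) ≤ Λ) (hΛ : 1 ≤ Λ) (hβ0 : 0 ≤ β) (hβ1 : β ≤ 1) :
    (L : ℝ) ^ (1 - β) ≤ Λ := by
  rcases le_or_gt 1 (L : ℝ) with h1 | h1
  · exact (rpow_one_sub_le_self h1 hβ0).trans hL
  · exact (Real.rpow_le_one (Nat.cast_nonneg L) h1.le (by linarith)).trans hΛ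

/-- **THE UNIT-WEIGHT RATE OF THE TELESCOPED ALL-RAW WINDOW UNDER READING (A)** [folklore] (arith): `0 < θ ≤ 1 ≤ c`,
`0 ≤ β ≤ 1`, `0 ≤ C`, nonnegative letters obeying `DictA θ c β C ℓ`, block side `L ≤ Λ` with `1 ≤ Λ` ⟹
`N_{(1,1,1)}(telWin C L β ℓ) ≤ sockConst c Λ · θ²`.  Gradient and Hölder slots: `T4CombSecondRaw.winN_printWin_second_
allRaw_tel_le` BY NAME (`≤ Aθ²`, `≤ Aθ^{2+β} ≤ Aθ²`, `A = 22c⁴ + L^{1−β}·73(118c⁵)⁵ ≤ sockConst c Λ`); sup slot: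
`C·s ≤ c·cθ² ≤ sockConst c Λ·θ²` directly (the printed weights would give it only at `θ¹·A`). -/
theorem winN_unit_telWin_le {L : ℕ} {θ c Λ β C : ℝ} {ℓ : Letters} (hθ : 0 < θ) (hθ1 : θ ≤ 1) (hβ0 : 0 ≤ β)
    (hβ1 : β ≤ 1) (hc1 : 1 ≤ c) (hC0 : 0 ≤ C) (hΛ : 1 ≤ Λ) (hL : (L : ℝ) ≤ Λ) (hn : ℓ.Nonneg)
    (hD : DictA θ c β C ℓ) : winN unitWin (telWin C L β ℓ) ≤ sockConst c Λ * θ ^ 2 := by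
  have hθ0 := hθ.le
  have hc0 : 0 ≤ c := by linarith
  have hK0 : (0 : ℝ) ≤ 73 * (118 * c ^ 5) ^ 5 := by positivity
  have hLβ : (L : ℝ) ^ (1 - β) ≤ Λ := rpow_one_sub_le_of_le hL hΛ hβ0 hβ1
  have hL0 : (0 : ℝ) ≤ (L : ℝ) ^ (1 - β) := Real.rpow_nonneg (Nat.cast_nonneg L) _
  have hA0 : (0 : ℝ) ≤ 22 * c ^ 4 + (L : ℝ) ^ (1 - β) * (73 * (118 * c ^ 5) ^ 5) := by positivity
  have hAA : 22 * c ^ 4 + (L : ℝ) ^ (1 - β) * (73 * (118 * c ^ 5) ^ 5) ≤ sockConst c Λ := by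
    unfold sockConst
    have := mul_le_mul_of_nonneg_right hLβ hK0
    linarith
  obtain ⟨-, h2, h3⟩ := (winN_printWin_le_iff hθ).1
    (winN_printWin_second_allRaw_tel_le (L := L) hθ hθ1 hβ0 hβ1 hc1 hC0 hn.hs hn.hq₀ hn.hq₁ hn.hτ₀ hn.hτ₁ hn.hγU
      hn.hγU₁ hn.hγ₀ hn.hγ₁ hn.hγγU hn.hγγP hn.hγγ₁ hD.count hD.dev hD.curv₀ hD.curv₁ hD.bond₀ hD.bond₁ hD.gradU₀
      hD.gradU₁ hD.gradP₀ hD.gradP₁ hD.hessU₀ hD.hessP₀ hD.hessP₁)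
  rw [winN_unitWin_le_iff]
  refine ⟨?_, ?_, ?_⟩
  · show C * ℓ.s ≤ sockConst c Λ * θ ^ 2
    have h : C * ℓ.s ≤ c * (c * θ ^ 2) := mul_le_mul hD.count hD.dev hn.hs hc0
    have hc24 : c ^ 2 ≤ c ^ 4 := pow_le_pow_right₀ hc1 (by norm_num)
    have hS : c ^ 2 ≤ sockConst c Λ := by
      unfold sockConst
      have : 0 ≤ Λ * (73 * (118 * c ^ 5) ^ 5) := mul_nonneg (by linarith) hK0
      nlinarith
    calc C * ℓ.s ≤ c ^ 2 * θ ^ 2 := h.trans_eq (by ring)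
      _ ≤ sockConst c Λ * θ ^ 2 := mul_le_mul_of_nonneg_right hS (by positivity)
  · have h2' : gradPoly C ℓ.s ℓ.q₀ ℓ.q₁ ℓ.τ₀ ℓ.τ₁ ℓ.γU ℓ.γ₀ ℓ.γ₁ + C * ℓ.s * ℓ.γU ≤
        (22 * c ^ 4 + (L : ℝ) ^ (1 - β) * (73 * (118 * c ^ 5) ^ 5)) * θ ^ 2 := h2
    exact h2'.trans (mul_le_mul_of_nonneg_right hAA (by positivity))
  · have h3' : (L : ℝ) ^ (1 - β) *
        secondDev C ℓ.s ℓ.q₀ ℓ.τ₀ (gradPoly C ℓ.s ℓ.q₀ ℓ.q₁ ℓ.τ₀ ℓ.τ₁ ℓ.γU ℓ.γ₀ ℓ.γ₁) ℓ.γU ℓ.γ₀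
          (devGradPoly C ℓ.s ℓ.q₁ ℓ.τ₀ ℓ.τ₁ ℓ.γ₀ ℓ.γ₁) ℓ.γγU ℓ.γγP
          (devHessPoly C ℓ.s ℓ.q₁ ℓ.τ₀ ℓ.τ₁ (gradPoly C ℓ.s ℓ.q₀ ℓ.q₁ ℓ.τ₀ ℓ.τ₁ ℓ.γU ℓ.γ₀ ℓ.γ₁) ℓ.γU ℓ.γU₁ ℓ.γ₁
            ℓ.γγP ℓ.γγ₁) ≤
        (22 * c ^ 4 + (L : ℝ) ^ (1 - β) * (73 * (118 * c ^ 5) ^ 5)) * θ ^ (2 + β) := h3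
    exact h3'.trans ((mul_le_mul_of_nonneg_left (rpow_printed_le_sq hθ hθ1 hβ0) hA0).trans
      (mul_le_mul_of_nonneg_right hAA (by positivity)))

end UnitRate

/-! ## §2  [folklore] The bundled producer: twelve raw block sups ⟹ window data `telWin` of the comb-gauge deviation -/

section Producer

/-- [folklore] THE TWELVE RAW BLOCK SUPS of a pair `(U₀, U₁)` on the block `B(z)` of side `L` — the hypotheses of
`T4CombSecondRaw.windowData_comb_second_allRaw_tel` VERBATIM as named fields: both configurations unitary-like; the
gauge-fixed relative plaquette deviation in the comb gauge `≤ s` (Lemma 1's format, [Balaban1985RegularSpaces] (1.24)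
p. 79 as typed in `T4RelativeComb`); curvatures `≤ q₀, q₁`; bond deviations `≤ τ₀, τ₁`; plain bond gradients
`≤ γU, γU₁`; plain plaquette gradients `≤ γ₀, γ₁`; plain second differences `≤ γγU, γγP, γγ₁`; all letters `≥ 0`.
HONEST: plain lattice differences, no parallel transport (HONEST SCOPE of `T4CombHolderWindow`). -/
structure RawSups (L : ℕ) (z : Site d) (U₀ U₁ : Cfg d R) (ℓ : Letters) : Prop where
  unit₀ : ∀ x ν, UnitaryLike (U₀ x ν)
  unit₁ : ∀ x ν, UnitaryLike (U₁ x ν)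
  dev : PlaqSup L z (fun y ρ ν => ‖(plaq (gaugeAct (combGauge U₀ U₁ z) U₁) y ρ ν : R) - plaq U₀ y ρ ν‖) ℓ.s
  curv₀ : PlaqSup L z (fun y ρ ν => ‖(plaq U₀ y ρ ν : R) - 1‖) ℓ.q₀
  curv₁ : PlaqSup L z (fun y ρ ν => ‖(plaq U₁ y ρ ν : R) - 1‖) ℓ.q₁
  bond₀ : ∀ x ρ, InBlock L z x → InBlock L z (x + e ρ) → ‖(U₀ x ρ : R) - 1‖ ≤ ℓ.τ₀
  bond₁ : ∀ x ρ, InBlock L z x → InBlock L z (x + e ρ) → ‖(U₁ x ρ : R) - 1‖ ≤ ℓ.τ₁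
  gradU₀ : ∀ μ x ρ, InBlock L z x → InBlock L z (x + e ρ) → InBlock L z (x + e μ) →
    InBlock L z (x + e μ + e ρ) → ‖(U₀ (x + e μ) ρ : R) - U₀ x ρ‖ ≤ ℓ.γU
  gradU₁ : ∀ μ x ρ, InBlock L z x → InBlock L z (x + e ρ) → InBlock L z (x + e μ) →
    InBlock L z (x + e μ + e ρ) → ‖(U₁ (x + e μ) ρ : R) - U₁ x ρ‖ ≤ ℓ.γU₁
  gradP₀ : ∀ μ y ρ ν', ρ ≠ ν' → InBlock L z y → InBlock L z (y + e ρ) → InBlock L z (y + e ν') →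
    InBlock L z (y + e ρ + e ν') → InBlock L z (y + e μ) → InBlock L z (y + e μ + e ρ) →
    InBlock L z (y + e μ + e ν') → InBlock L z (y + e μ + e ρ + e ν') →
    ‖(plaq U₀ (y + e μ) ρ ν' : R) - plaq U₀ y ρ ν'‖ ≤ ℓ.γ₀
  gradP₁ : ∀ μ y ρ ν', ρ ≠ ν' → InBlock L z y → InBlock L z (y + e ρ) → InBlock L z (y + e ν') →
    InBlock L z (y + e ρ + e ν') → InBlock L z (y + e μ) → InBlock L z (y + e μ + e ρ) →
    InBlock L z (y + e μ + e ν') → InBlock L z (y + e μ + e ρ + e ν') →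
    ‖(plaq U₁ (y + e μ) ρ ν' : R) - plaq U₁ y ρ ν'‖ ≤ ℓ.γ₁
  hessU₀ : ∀ μ ρ x α, InBlock L z x → InBlock L z (x + e μ + e ρ + e α) →
    ‖(U₀ (x + e μ + e ρ) α : R) - U₀ (x + e μ) α - U₀ (x + e ρ) α + U₀ x α‖ ≤ ℓ.γγU
  hessP₀ : ∀ μ ρ y α ν', α ≠ ν' → InBlock L z y → InBlock L z (y + e μ + e ρ + e α + e ν') →
    ‖(plaq U₀ (y + e μ + e ρ) α ν' : R) - plaq U₀ (y + e μ) α ν' - plaq U₀ (y + e ρ) α ν' +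
        plaq U₀ y α ν'‖ ≤ ℓ.γγP
  hessP₁ : ∀ μ ρ y α ν', α ≠ ν' → InBlock L z y → InBlock L z (y + e μ + e ρ + e α + e ν') →
    ‖(plaq U₁ (y + e μ + e ρ) α ν' : R) - plaq U₁ (y + e μ) α ν' - plaq U₁ (y + e ρ) α ν' +
        plaq U₁ y α ν'‖ ≤ ℓ.γγ₁
  nonneg : ℓ.Nonneg

variable [NormOneClass R] {L : ℕ} {z : Site d}

/-- **THE BUNDLED PRODUCER** [folklore]: raw block sups `RawSups L z U₀ U₁ ℓ`, `β ≤ 1`, `0 ≤ (d−1)(L−1)` ⟹ window data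
of the zero-extended comb-gauge block deviation with the telescoped triple `telWin ((d−1)(L−1)) L β ℓ` —
`T4CombSecondRaw.windowData_comb_second_allRaw_tel` BY NAME (`G_raw = gradPoly ((d−1)(L−1)) …`,
`γE_raw = devGradPoly ((d−1)(L−1)) …` definitionally, `T4CombSecondDifference.gradRaw_eq_gradPoly` /
`devGradRaw_eq_devGradPoly`). -/
theorem windowData_telWin {U₀ U₁ : Cfg d R} {β : ℝ} {ℓ : Letters} (hβ1 : β ≤ 1)
    (hC0 : 0 ≤ ((d : ℝ) - 1) * ((L : ℝ) - 1)) (h : RawSups L z U₀ U₁ ℓ) :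
    WindowData L z β (blockDev L z (combGauge U₀ U₁ z) U₀ U₁) (telWin (((d : ℝ) - 1) * ((L : ℝ) - 1)) L β ℓ) := by
  have hW := windowData_comb_second_allRaw_tel hβ1 hC0 h.unit₀ h.unit₁ h.dev h.curv₀ h.curv₁ h.bond₀ h.bond₁
    h.gradU₀ h.gradU₁ h.gradP₀ h.gradP₁ h.hessU₀ h.hessP₀ h.hessP₁ h.nonneg.hs h.nonneg.hq₀ h.nonneg.hq₁
    h.nonneg.hτ₀ h.nonneg.hτ₁ h.nonneg.hγU h.nonneg.hγU₁ h.nonneg.hγ₀ h.nonneg.hγ₁ h.nonneg.hγγU h.nonneg.hγγP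
    h.nonneg.hγγ₁
  rw [gradRaw_eq_gradPoly, devGradRaw_eq_devGradPoly] at hW
  exact hW

/-- [folklore] THE PER-PAIR PRODUCER IN THE CONSUMER'S CURRENCY: raw sups + the dictionary at `θ` (`0 < θ ≤ 1 ≤ c`,
`0 ≤ β ≤ 1`, `0 ≤ (d−1)(L−1)`, `L ≤ Λ`, `1 ≤ Λ`) ⟹ SOME window data `b_w` of the comb-gauge block deviation with
`N_{(1,1,1)}(b_w) ≤ sockConst c Λ · θ²`. -/
theorem exists_windowData_unit {U₀ U₁ : Cfg d R} {β θ c Λ : ℝ} {ℓ : Letters} (hθ : 0 < θ) (hθ1 : θ ≤ 1)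
    (hβ0 : 0 ≤ β) (hβ1 : β ≤ 1) (hc1 : 1 ≤ c) (hΛ : 1 ≤ Λ) (hL : (L : ℝ) ≤ Λ)
    (hC0 : 0 ≤ ((d : ℝ) - 1) * ((L : ℝ) - 1)) (h : RawSups L z U₀ U₁ ℓ)
    (hD : DictA θ c β (((d : ℝ) - 1) * ((L : ℝ) - 1)) ℓ) :
    ∃ bw : Win, WindowData L z β (blockDev L z (combGauge U₀ U₁ z) U₀ U₁) bw ∧
      winN unitWin bw ≤ sockConst c Λ * θ ^ 2 :=
  ⟨_, windowData_telWin hβ1 hC0 h, winN_unit_telWin_le hθ hθ1 hβ0 hβ1 hc1 hC0 hΛ hL h.nonneg hD⟩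

end Producer

/-! ## §3  [folklore] The socket: the comb-raw feed ⟹ `TransportsFrom`, and the K-uniform budget end to end -/

section Socket

variable [NormOneClass R] [NormedAlgebra ℂ R] {F : Type*} [NormedAddCommGroup F] [NormedSpace ℂ F] [CompleteSpace F]
variable {B : Booking} {T : Trajectory B}

/-- **THE COMB-RAW FEED ⟹ `TransportsFrom`** [folklore] (= `T4TrajectoryComparison.transportsFrom_of_window` with the
comb lineage's producer plugged into its hypothesis `hlin`; weights `(1,1,1)`, `c_δ = sockConst c Λ`, `ψ = ϑ²`).
Per generation `(b, k′)`: `Fn b k′` invariant under `BlockRel (Lg b k′) (zg b k′)` with a birth slice along UNIT-WEIGHT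
window directions of its block (chart `wMove`, norm `wN … unitWin`, radius `r > 0`, window `w ≥ sockConst c Λ`, sup
`gen b k′`); READING (A) AS LOCATED BINDERS: block sides `Lg b k′ ≤ Λ` (`1 ≤ Λ`) with `0 ≤ (d−1)(Lg b k′−1) ≤ c`
(`1 ≤ c`); `0 ≤ β ≤ 1`; a scale ratio `0 < ϑ ≤ 1`; and (`hfeed`) for `j ≤ k′ ≤ k ≤ K` under `RanBelow Gate k` the size
`lin b k′ k` attained up to every `ε > 0` by the response to a pair `(U₀, U₁)`, base in `𝒦 b k′`, with raw block sups
`RawSups (Lg b k′) (zg b k′) U₀ U₁ ℓ` obeying the dictionary `DictA (ϑ^{k−k′}) c β ((d−1)(Lg b k′−1)) ℓ`.  THEN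
`TransportsFrom (4·sockConst c Λ/r) (ϑ²) Gate`.  The block gauge handed to the consumer is the comb gauge
`combGauge U₀ U₁ (zg b k′)` (unitary-like, `T4RelativeComb.unitaryLike_combGauge`); `(ϑ^{k−k′})² = (ϑ²)^{k−k′}`.
NOT asserted for the cell's terms: every input is a binder. -/
theorem transportsFrom_of_combRaw {Gate : ℕ → Prop} {Fn : B.Birth → ℕ → Fld d R → F}
    {Lg : B.Birth → ℕ → ℕ} {zg : B.Birth → ℕ → Site d} {𝒦 : B.Birth → ℕ → Set (Fld d R)}
    {β : ℝ} {w r c Λ ϑ : ℝ}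
    (hinv : ∀ b k', GaugeInvariant (BlockRel (Lg b k') (zg b k')) (Fn b k'))
    (hsl : ∀ b k', BirthSlice (Fn b k') (wMove (Lg b k') (zg b k') β) (wN (Lg b k') (zg b k') β unitWin) (𝒦 b k')
      w r (T.gen b k'))
    (hr : 0 < r) (hβ0 : 0 ≤ β) (hβ1 : β ≤ 1) (hc1 : 1 ≤ c) (hΛ : 1 ≤ Λ) (hϑ : 0 < ϑ) (hϑ1 : ϑ ≤ 1)
    (hw : sockConst c Λ ≤ w) (hL : ∀ b k', (Lg b k' : ℝ) ≤ Λ)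
    (hCnn : ∀ b k', 0 ≤ ((d : ℝ) - 1) * ((Lg b k' : ℝ) - 1))
    (hCc : ∀ b k', ((d : ℝ) - 1) * ((Lg b k' : ℝ) - 1) ≤ c)
    (hfeed : ∀ (b : B.Birth) (k' k : ℕ), B.birthScale b ≤ k' → k' ≤ k → k ≤ B.K → RanBelow Gate k → ∀ ε > 0,
      ∃ U₀ U₁ : Cfg d R, ∃ ℓ : Letters, val U₀ ∈ 𝒦 b k' ∧ RawSups (Lg b k') (zg b k') U₀ U₁ ℓ ∧
        DictA (ϑ ^ (k - k')) c β (((d : ℝ) - 1) * ((Lg b k' : ℝ) - 1)) ℓ ∧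
        T.lin b k' k ≤ ‖Fn b k' (val U₁) - Fn b k' (val U₀)‖ + ε) :
    T.TransportsFrom (4 * sockConst c Λ / r) (ϑ ^ 2) Gate := by
  have hΛ0 : 0 ≤ Λ := zero_le_one.trans hΛ
  refine transportsFrom_of_window hinv hsl unitWin_pos hr (pow_nonneg hϑ.le 2) (pow_le_one₀ hϑ.le hϑ1)
    (sockConst_nonneg (zero_le_one.trans hc1) hΛ0) hw ?_
  intro b k' k hbk' hk'k hk hran ε hε
  obtain ⟨U₀, U₁, ℓ, hU₀𝒦, hR, hD, hle⟩ := hfeed b k' k hbk' hk'k hk hran ε hε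
  have hθ : 0 < ϑ ^ (k - k') := pow_pos hϑ _
  have hθ1 : ϑ ^ (k - k') ≤ 1 := pow_le_one₀ hϑ.le hϑ1
  obtain ⟨bw, hW, hbw⟩ := exists_windowData_unit hθ hθ1 hβ0 hβ1 hc1 hΛ (hL b k') (hCnn b k') hR
    ⟨(hCc b k'), hD.dev, hD.curv₀, hD.curv₁, hD.bond₀, hD.bond₁, hD.gradU₀, hD.gradU₁, hD.gradP₀, hD.gradP₁,
      hD.hessU₀, hD.hessP₀, hD.hessP₁⟩
  refine ⟨U₀, U₁, combGauge U₀ U₁ (zg b k'), bw, hU₀𝒦, unitaryLike_combGauge hR.unit₀ hR.unit₁ _, hW, ?_, hle⟩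
  calc winN unitWin bw ≤ sockConst c Λ * (ϑ ^ (k - k')) ^ 2 := hbw
    _ = sockConst c Λ * (ϑ ^ 2) ^ (k - k') := by rw [← pow_mul, ← pow_mul, Nat.mul_comm]

/-- **END TO END WITH THE COMB-RAW FEED (strict product, bounded weights — K-UNIFORM)** [folklore]
(= `T4TrajectoryComparison.latticeTrajectory_budget_window_strict` with the comb lineage's producer plugged in:
`transportsFrom_of_combRaw` under the history of the returned gate `(TOB-k) ∧ H`, then
`T4TrajectoryComparison.Trajectory.sizeBound_cubeBudget_of_trajectory_strict` BY NAME).  Any `C ≥ 4·sockConst c Λ/r`,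
regeneration `cR ≥ 0` under the same history, births `Â·τ^{K−j}`, positional count `N₀·Λc^{k−j}`, weights
`0 ≤ wt j ≤ w̄`, the strict product `Λc·(ϑ² + C·cR)·τ ≤ r′ < 1`, and `H` met from the sizes ⟹
`SizeBound (twoRate K (C·Â) (ϑ² + C·cR) τ)`, the K-uniform budget `CubeBudget wt ((N₀·(C·Â))·w̄·(1−r′)⁻¹)` and `H k` at
every scale.  NOT asserted for the cell's terms. -/
theorem latticeTrajectory_budget_combRaw_strict {Fn : B.Birth → ℕ → Fld d R → F}
    {Lg : B.Birth → ℕ → ℕ} {zg : B.Birth → ℕ → Site d} {𝒦 : B.Birth → ℕ → Set (Fld d R)}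
    {β : ℝ} {w r c Λ ϑ : ℝ} {N : ℕ → ℕ → ℝ} {wt : ℕ → ℝ} {N₀ Λc wbar C cR Ahat τ r' : ℝ} {H : ℕ → Prop}
    (hinv : ∀ b k', GaugeInvariant (BlockRel (Lg b k') (zg b k')) (Fn b k'))
    (hsl : ∀ b k', BirthSlice (Fn b k') (wMove (Lg b k') (zg b k') β) (wN (Lg b k') (zg b k') β unitWin) (𝒦 b k')
      w r (T.gen b k'))
    (hr : 0 < r) (hβ0 : 0 ≤ β) (hβ1 : β ≤ 1) (hc1 : 1 ≤ c) (hΛ : 1 ≤ Λ) (hϑ : 0 < ϑ) (hϑ1 : ϑ ≤ 1)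
    (hww : sockConst c Λ ≤ w) (hL : ∀ b k', (Lg b k' : ℝ) ≤ Λ)
    (hCnn : ∀ b k', 0 ≤ ((d : ℝ) - 1) * ((Lg b k' : ℝ) - 1))
    (hCc : ∀ b k', ((d : ℝ) - 1) * ((Lg b k' : ℝ) - 1) ≤ c) (hCle : 4 * sockConst c Λ / r ≤ C)
    (hfeed : ∀ (b : B.Birth) (k' k : ℕ), B.birthScale b ≤ k' → k' ≤ k → k ≤ B.K →
      RanBelow (fun i => CubeBudgetAt B wt ((N₀ * (C * Ahat)) * wbar * (1 - r')⁻¹) i ∧ H i) k → ∀ ε > 0,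
      ∃ U₀ U₁ : Cfg d R, ∃ ℓ : Letters, val U₀ ∈ 𝒦 b k' ∧ RawSups (Lg b k') (zg b k') U₀ U₁ ℓ ∧
        DictA (ϑ ^ (k - k')) c β (((d : ℝ) - 1) * ((Lg b k' : ℝ) - 1)) ℓ ∧
        T.lin b k' k ≤ ‖Fn b k' (val U₁) - Fn b k' (val U₀)‖ + ε)
    (hw : ∀ j, j ≤ B.K → 0 ≤ wt j) (hwb : ∀ j, j ≤ B.K → wt j ≤ wbar) (hN : B.PositionalCount N)
    (hNle : ∀ j k, j ≤ k → k ≤ B.K → N j k ≤ N₀ * Λc ^ (k - j)) (hN₀ : 0 ≤ N₀) (hΛc : 0 ≤ Λc)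
    (hcR : 0 ≤ cR) (hAhat : 0 ≤ Ahat) (hτ0 : 0 ≤ τ) (hτ1 : τ ≤ 1)
    (hprod : Λc * (ϑ ^ 2 + C * cR) * τ ≤ r') (hr'1 : r' < 1) (h0 : T.BirthGen Ahat τ)
    (hreg : T.RegeneratesFrom cR (fun k => CubeBudgetAt B wt ((N₀ * (C * Ahat)) * wbar * (1 - r')⁻¹) k ∧ H k))
    (hH : GateOfSizes B (twoRate B.K (C * Ahat) (ϑ ^ 2 + C * cR) τ) H) :
    B.SizeBound (twoRate B.K (C * Ahat) (ϑ ^ 2 + C * cR) τ) ∧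
      B.CubeBudget wt ((N₀ * (C * Ahat)) * wbar * (1 - r')⁻¹) ∧ ∀ k, k ≤ B.K → H k := by
  have hΛ0 : 0 ≤ Λ := zero_le_one.trans hΛ
  have hψ : (0 : ℝ) ≤ ϑ ^ 2 := pow_nonneg hϑ.le 2
  have hC0 : 0 ≤ 4 * sockConst c Λ / r :=
    div_nonneg (mul_nonneg (by norm_num) (sockConst_nonneg (zero_le_one.trans hc1) hΛ0)) hr.le
  have hCC : 0 ≤ C := hC0.trans hCle
  have htr := (transportsFrom_of_combRaw hinv hsl hr hβ0 hβ1 hc1 hΛ hϑ hϑ1 hww hL hCnn hCc hfeed).mono hCle hψ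
    le_rfl hCC
  exact Trajectory.sizeBound_cubeBudget_of_trajectory_strict hw hwb hN hNle hN₀ hΛc hCC hψ hcR hAhat hτ0 hτ1 hprod
    hr'1 h0 htr hreg hH

end Socket

/-! ## §4  [folklore] Non-vacuity -/

section Witness

/-- [folklore] The zero letters. -/
def Letters.zero : Letters := ⟨0, 0, 0, 0, 0, 0, 0, 0, 0, 0, 0, 0⟩

/-- [folklore] The zero letters are nonnegative. -/
theorem Letters.zero_nonneg : Letters.zero.Nonneg :=
  ⟨le_rfl, le_rfl, le_rfl, le_rfl, le_rfl, le_rfl, le_rfl, le_rfl, le_rfl, le_rfl, le_rfl, le_rfl⟩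

/-- [folklore] The zero letters obey the dictionary for any `0 < θ`, `0 ≤ c`, `C ≤ c`. -/
theorem dictA_zero {θ c β C : ℝ} (hθ : 0 < θ) (hc : 0 ≤ c) (hC : C ≤ c) : DictA θ c β C Letters.zero := by
  have h2 : (0 : ℝ) ≤ c * θ ^ 2 := by positivity
  have h1 : (0 : ℝ) ≤ c * θ := by positivity
  have hr : (0 : ℝ) ≤ c * θ ^ (2 + β) := mul_nonneg hc (Real.rpow_nonneg hθ.le _)
  exact ⟨hC, h2, h2, h2, h1, h1, h2, h2, hr, hr, hr, hr, hr⟩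

/-- [folklore] NON-VACUITY OF THE PRODUCER'S HYPOTHESES: the flat pair `U₀ = U₁ ≡ 1` over `ℝ` on any block has raw
block sups with ALL TWELVE LETTERS `0` (the comb gauge of the flat pair is trivial,
`T4RelativeCombGradient.combGauge_self`). -/
theorem rawSups_flat (d L : ℕ) (z : Site d) :
    RawSups (R := ℝ) L z (fun _ _ => (1 : ℝˣ)) (fun _ _ => 1) Letters.zero := by
  have hg : combGauge (fun _ _ => (1 : ℝˣ)) (fun _ _ => (1 : ℝˣ)) z = fun _ => 1 :=
    funext fun x => combGauge_self (d := d) (fun _ _ => (1 : ℝˣ)) z x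
  have h1 : UnitaryLike (1 : ℝˣ) := UnitaryLike.one
  exact
    { unit₀ := fun _ _ => h1
      unit₁ := fun _ _ => h1
      dev := by intro y ρ ν' _ _ _ _ _; simp [hg, gaugeAct, plaq, Letters.zero]
      curv₀ := by intro y ρ ν' _ _ _ _ _; simp [plaq, Letters.zero]
      curv₁ := by intro y ρ ν' _ _ _ _ _; simp [plaq, Letters.zero]
      bond₀ := by intro x ρ _ _; simp [Letters.zero]
      bond₁ := by intro x ρ _ _; simp [Letters.zero]
      gradU₀ := by intro μ x ρ _ _ _ _; simp [Letters.zero]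
      gradU₁ := by intro μ x ρ _ _ _ _; simp [Letters.zero]
      gradP₀ := by intro μ y ρ ν' _ _ _ _ _ _ _ _ _; simp [plaq, Letters.zero]
      gradP₁ := by intro μ y ρ ν' _ _ _ _ _ _ _ _ _; simp [plaq, Letters.zero]
      hessU₀ := by intro μ ρ x α _ _; simp [Letters.zero]
      hessP₀ := by intro μ ρ y α ν' _ _ _; simp [plaq, Letters.zero]
      hessP₁ := by intro μ ρ y α ν' _ _ _; simp [plaq, Letters.zero]
      nonneg := Letters.zero_nonneg }

/-- [folklore] Hence the flat pair has window data of its (trivial) comb-gauge deviation inside the unit-weight window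
at the rate `sockConst c Λ · θ²`, for every `0 < θ ≤ 1 ≤ c`, `0 ≤ β ≤ 1`, block side `L ≤ Λ` with
`0 ≤ (d−1)(L−1) ≤ c` — the per-pair content of §3's feed is jointly satisfiable. -/
example (d L : ℕ) (z : Site d) {β θ c Λ : ℝ} (hθ : 0 < θ) (hθ1 : θ ≤ 1) (hβ0 : 0 ≤ β) (hβ1 : β ≤ 1)
    (hc1 : 1 ≤ c) (hΛ : 1 ≤ Λ) (hL : (L : ℝ) ≤ Λ) (hC0 : 0 ≤ ((d : ℝ) - 1) * ((L : ℝ) - 1))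
    (hC : ((d : ℝ) - 1) * ((L : ℝ) - 1) ≤ c) :
    ∃ bw : Win, WindowData L z β (blockDev L z (combGauge (fun _ _ => (1 : ℝˣ)) (fun _ _ => 1) z)
      (fun _ _ => (1 : ℝˣ)) (fun _ _ => 1)) bw ∧ winN unitWin bw ≤ sockConst c Λ * θ ^ 2 :=
  exists_windowData_unit hθ hθ1 hβ0 hβ1 hc1 hΛ hL hC0 (rawSups_flat d L z)
    (dictA_zero hθ (zero_le_one.trans hc1) hC)

/-- [folklore] Non-vacuity of the consumer-side formats handed over: a constant block functional is `BlockRel`-invariant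
with a unit-weight window birth slice (pv24-g11's witnesses `T4CombHolderWindow.gaugeInvariant_const` /
`birthSlice_window_const` BY NAME), and the unit weights are positive. -/
example [NormOneClass R] [NormedAlgebra ℂ R] {F : Type*} [NormedAddCommGroup F] [NormedSpace ℂ F] (L : ℕ)
    (z : Site d) (β : ℝ) (cF : F) (𝒦 : Set (Fld d R)) (w r : ℝ) :
    GaugeInvariant (BlockRel (R := R) L z) (fun _ => cF) ∧
      BirthSlice (fun _ : Fld d R => cF) (wMove L z β) (wN L z β unitWin) 𝒦 w r ‖cF‖ ∧ unitWin.Pos :=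
  ⟨T4CombHolderWindow.gaugeInvariant_const L z cF, T4CombHolderWindow.birthSlice_window_const unitWin 𝒦 w r le_rfl,
    unitWin_pos⟩

end Witness

/-! ## §5  [arith] The small-field parameter: `ε`-homogeneity of the telescoped window and the `ε`-socket

With `1 ≤ c` (needed by the producer's rate lemma) the socket of §3 asks for a birth-slice window
`w ≥ sockConst c Λ ≥ 22` in ABSOLUTE letter units, while the printed analyticity window (3.31) is `α₂`-small.  The
honest repair is a SMALLNESS PARAMETER `ε ∈ (0, 1]` carried by the twelve letters (`DictE`: letters
`≤ ε·(dictionary of reading (A))`) — in print the three slots of (1.36) share ONE small factor `B₁(α₀+α₁)` resp.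
`B₂(β₀)(α₀+α₁)` in front of the scale powers, which is exactly this shape (FORMAT only; nothing asserted for
Bałaban's configurations).  Every monomial of the three slot polynomials of `telWin` has degree `≥ 1` in the letters
and nonnegative coefficients, so scaling the letters by `ε ≤ 1` scales each slot by at most `ε`
(`telWin_scale_le`); hence `N_{(1,1,1)}(telWin) ≤ ε·sockConst c Λ·θ²` under `DictE` (`winN_unit_telWin_le_eps`) and
the socket closes with `c_δ = ε·sockConst c Λ`, i.e. under the window hypothesis `ε·sockConst c Λ ≤ w`
(`transportsFrom_of_combRaw_eps`, `latticeTrajectory_budget_combRaw_eps_strict`).  §3 is the case `ε = 1`. -/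

section Eps

open T4CombSecondDifference (mapGrad mapHess devHess secondSrc secondFoot secondW gradPoly_nonneg
  devGradPoly_nonneg secondDev_nonneg)
open T4CombSecondRaw (gaugeStep gaugeHess gaugeStep_nonneg gaugeHess_nonneg devHessPoly_nonneg)

variable {ε C s q₀ q₁ τ τ₀ τ₁ γU γU₁ γP γ₀ γ₁ γE γE' γγU γγP γγ₁ γγE γγE' G G' b b' : ℝ}

/-- [folklore] (arith) `ε² ≤ ε` on `[0, 1]`. -/
theorem mul_self_le_of_unit (hε0 : 0 ≤ ε) (hε1 : ε ≤ 1) : ε * ε ≤ ε := by nlinarith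

/-- [folklore] (arith) `ε³ ≤ ε` on `[0, 1]`. -/
theorem mul_mul_self_le_of_unit (hε0 : 0 ≤ ε) (hε1 : ε ≤ 1) : ε * ε * ε ≤ ε := by
  have := mul_self_le_of_unit hε0 hε1; nlinarith

/-- [folklore] (arith) The comb-gauge step letter is LINEAR in the letters:
`δ_g(C; εs, ετ₀, ετ₁) = ε·δ_g(C; s, τ₀, τ₁)`. -/
theorem gaugeStep_scale : gaugeStep C (ε * s) (ε * τ₀) (ε * τ₁) = ε * gaugeStep C s τ₀ τ₁ := by
  unfold gaugeStep; ring

/-- [folklore] (arith) `ε`-homogeneity of the comb-gauge second-difference letter `δδ_g` (the gradient slot `G`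
replaced by any `G′ ≤ εG`). -/
theorem gaugeHess_scale_le (hε0 : 0 ≤ ε) (hε1 : ε ≤ 1) (hC : 0 ≤ C) (hs : 0 ≤ s) (hτ0 : 0 ≤ τ₀) (hτ1 : 0 ≤ τ₁)
    (hγU1 : 0 ≤ γU₁) (hG' : G' ≤ ε * G) :
    gaugeHess C (ε * s) (ε * τ₀) (ε * τ₁) G' (ε * γU) (ε * γU₁) ≤ ε * gaugeHess C s τ₀ τ₁ G γU γU₁ := by
  have hg := gaugeStep_nonneg hC hs hτ0 hτ1
  have hε2 := mul_self_le_of_unit hε0 hε1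
  have h1 : 0 ≤ (τ₀ + C * s) * (gaugeStep C s τ₀ τ₁ + γU₁) := by positivity
  have h2 : 0 ≤ gaugeStep C s τ₀ τ₁ * τ₁ := by positivity
  unfold gaugeHess
  rw [gaugeStep_scale]
  nlinarith [mul_le_mul_of_nonneg_right hε2 h1, mul_le_mul_of_nonneg_right hε2 h2]

/-- [folklore] (arith) `ε`-homogeneity of `γγE_raw = devHessPoly`. -/
theorem devHessPoly_scale_le (hε0 : 0 ≤ ε) (hε1 : ε ≤ 1) (hC : 0 ≤ C) (hs : 0 ≤ s) (hq1 : 0 ≤ q₁) (hτ0 : 0 ≤ τ₀)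
    (hτ1 : 0 ≤ τ₁) (hG : 0 ≤ G) (hγU : 0 ≤ γU) (hγU1 : 0 ≤ γU₁) (hγ1 : 0 ≤ γ₁) (hG' : G' ≤ ε * G) :
    devHessPoly C (ε * s) (ε * q₁) (ε * τ₀) (ε * τ₁) G' (ε * γU) (ε * γU₁) (ε * γ₁) (ε * γγP) (ε * γγ₁) ≤
      ε * devHessPoly C s q₁ τ₀ τ₁ G γU γU₁ γ₁ γγP γγ₁ := by
  have hg := gaugeStep_nonneg hC hs hτ0 hτ1
  have hH := gaugeHess_nonneg hC hs hτ0 hτ1 hG hγU hγU1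
  have hH' := gaugeHess_scale_le (γU := γU) hε0 hε1 hC hs hτ0 hτ1 hγU1 hG'
  have hε2 := mul_self_le_of_unit hε0 hε1
  have hε3 := mul_mul_self_le_of_unit hε0 hε1
  have h1 : 0 ≤ 4 * gaugeStep C s τ₀ τ₁ * γ₁ := by positivity
  have h2 : 0 ≤ 2 * (ε * q₁) := by positivity
  have h3 : 0 ≤ 2 * q₁ * gaugeHess C s τ₀ τ₁ G γU γU₁ := by positivity
  have h4 : 0 ≤ 4 * q₁ * gaugeStep C s τ₀ τ₁ ^ 2 := by positivity
  unfold devHessPoly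
  rw [gaugeStep_scale]
  nlinarith [mul_le_mul_of_nonneg_right hε2 h1, mul_le_mul_of_nonneg_left hH' h2,
    mul_le_mul_of_nonneg_right hε2 h3, mul_le_mul_of_nonneg_right hε3 h4]

/-- [folklore] (arith) `ε`-homogeneity of `G_raw = gradPoly`. -/
theorem gradPoly_scale_le (hε0 : 0 ≤ ε) (hε1 : ε ≤ 1) (hC : 0 ≤ C) (hs : 0 ≤ s) (hq0 : 0 ≤ q₀) (hq1 : 0 ≤ q₁)
    (hτ0 : 0 ≤ τ₀) (hτ1 : 0 ≤ τ₁) (hγU : 0 ≤ γU) (hγ0 : 0 ≤ γ₀) :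
    gradPoly C (ε * s) (ε * q₀) (ε * q₁) (ε * τ₀) (ε * τ₁) (ε * γU) (ε * γ₀) (ε * γ₁) ≤
      ε * gradPoly C s q₀ q₁ τ₀ τ₁ γU γ₀ γ₁ := by
  have hε2 := mul_self_le_of_unit hε0 hε1
  have h1 : 0 ≤ s * (C * (2 * q₀ + s + 2 * τ₀)) := by positivity
  have h2 : 0 ≤ C * (2 * γU * (C * s + s)) := by positivity
  have h3 : 0 ≤ C * (2 * q₁ * (τ₀ + C * s + τ₁)) := by positivity
  have h4 : 0 ≤ C * (γ₀ * (2 * (C * s) + s)) := by positivity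
  unfold gradPoly
  nlinarith [mul_le_mul_of_nonneg_right hε2 h1, mul_le_mul_of_nonneg_right hε2 h2,
    mul_le_mul_of_nonneg_right hε2 h3, mul_le_mul_of_nonneg_right hε2 h4]

/-- [folklore] (arith) `ε`-homogeneity of `γE_raw = devGradPoly`. -/
theorem devGradPoly_scale_le (hε0 : 0 ≤ ε) (hε1 : ε ≤ 1) (hC : 0 ≤ C) (hs : 0 ≤ s) (hq1 : 0 ≤ q₁)
    (hτ0 : 0 ≤ τ₀) (hτ1 : 0 ≤ τ₁) :
    devGradPoly C (ε * s) (ε * q₁) (ε * τ₀) (ε * τ₁) (ε * γ₀) (ε * γ₁) ≤ ε * devGradPoly C s q₁ τ₀ τ₁ γ₀ γ₁ := by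
  have hε2 := mul_self_le_of_unit hε0 hε1
  have h1 : 0 ≤ 2 * q₁ * (τ₀ + C * s + τ₁) := by positivity
  unfold devGradPoly
  nlinarith [mul_le_mul_of_nonneg_right hε2 h1]

/-- [folklore] (arith) `ε`-homogeneity of `mapGrad` (the deviation-gradient slot `γE` replaced by any `γE′ ≤ εγE`). -/
theorem mapGrad_scale_le (hγE' : γE' ≤ ε * γE) :
    mapGrad (ε * γU) (ε * γP) γE' ≤ ε * mapGrad γU γP γE := by
  unfold mapGrad; nlinarith [hγE']

/-- [folklore] (arith) `ε`-homogeneity of `mapHess`. -/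
theorem mapHess_scale_le (hε0 : 0 ≤ ε) (hε1 : ε ≤ 1) (hγU : 0 ≤ γU) (hγP : 0 ≤ γP) (hγE : 0 ≤ γE)
    (hγE' : γE' ≤ ε * γE) (hγγE' : γγE' ≤ ε * γγE) :
    mapHess (ε * γU) (ε * γP) γE' (ε * γγU) (ε * γγP) γγE' ≤ ε * mapHess γU γP γE γγU γγP γγE := by
  have hε2 := mul_self_le_of_unit hε0 hε1
  have h1 : 0 ≤ 2 * (ε * γP) := by positivity
  have h2 : 0 ≤ 4 * (ε * γU) := by positivity
  have h3 : 0 ≤ 4 * γP ^ 2 + 4 * γU ^ 2 + 2 * γP * γE + 4 * γU * γE + 8 * γU * γP := by positivity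
  unfold mapHess
  nlinarith [mul_le_mul_of_nonneg_left hγE' h1, mul_le_mul_of_nonneg_left hγE' h2,
    mul_le_mul_of_nonneg_right hε2 h3]

/-- [folklore] (arith) `ε`-homogeneity of `devHess`. -/
theorem devHess_scale_le (hε0 : 0 ≤ ε) (hε1 : ε ≤ 1) (hs : 0 ≤ s) (hγU : 0 ≤ γU) (hγP : 0 ≤ γP) (hγE : 0 ≤ γE)
    (hγγU : 0 ≤ γγU) (hγγP : 0 ≤ γγP) (hγE' : γE' ≤ ε * γE) (hγγE' : γγE' ≤ ε * γγE) :
    devHess (ε * s) (ε * γU) (ε * γP) γE' (ε * γγU) (ε * γγP) γγE' ≤ ε * devHess s γU γP γE γγU γγP γγE := by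
  have hε2 := mul_self_le_of_unit hε0 hε1
  have hε3 := mul_mul_self_le_of_unit hε0 hε1
  have h1 : 0 ≤ 2 * (ε * γP) := by positivity
  have h2 : 0 ≤ 4 * (ε * γU) := by positivity
  have h3 : 0 ≤ 2 * γP * γE + 4 * γU * γE + s * (γγP + 2 * γγU) := by positivity
  have h4 : 0 ≤ s * (2 * γP ^ 2 + 4 * γU * γP + 4 * γU ^ 2) := by positivity
  unfold devHess
  nlinarith [mul_le_mul_of_nonneg_left hγE' h1, mul_le_mul_of_nonneg_left hγE' h2,
    mul_le_mul_of_nonneg_right hε2 h3, mul_le_mul_of_nonneg_right hε3 h4]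

/-- [folklore] (arith) `ε`-homogeneity of `secondSrc` (slots `b′ ≤ εb`, `G′ ≤ εG`, `γE′ ≤ εγE`, `γγE′ ≤ εγγE`). -/
theorem secondSrc_scale_le (hε0 : 0 ≤ ε) (hε1 : ε ≤ 1) (hs : 0 ≤ s) (hb : 0 ≤ b) (hG : 0 ≤ G) (hγU : 0 ≤ γU)
    (hγP : 0 ≤ γP) (hγE : 0 ≤ γE) (hγγU : 0 ≤ γγU) (hγγP : 0 ≤ γγP) (hγγE : 0 ≤ γγE) (hb' : b' ≤ ε * b)
    (hG' : G' ≤ ε * G) (hγE'0 : 0 ≤ γE') (hγE' : γE' ≤ ε * γE) (hγγE'0 : 0 ≤ γγE') (hγγE' : γγE' ≤ ε * γγE) :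
    secondSrc (ε * s) b' G' (ε * γU) (ε * γP) γE' (ε * γγU) (ε * γγP) γγE' ≤
      ε * secondSrc s b G γU γP γE γγU γγP γγE := by
  have hε2 := mul_self_le_of_unit hε0 hε1
  have hM' := mapGrad_scale_le (γU := γU) (γP := γP) hγE'
  have hM'0 : 0 ≤ mapGrad (ε * γU) (ε * γP) γE' := by unfold mapGrad; positivity
  have hM0 : 0 ≤ mapGrad γU γP γE := by unfold mapGrad; positivity
  have hH' := mapHess_scale_le (γγU := γγU) (γγP := γγP) hε0 hε1 hγU hγP hγE hγE' hγγE'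
  have hH'0 : 0 ≤ mapHess (ε * γU) (ε * γP) γE' (ε * γγU) (ε * γγP) γγE' := by unfold mapHess; positivity
  have hH0 : 0 ≤ mapHess γU γP γE γγU γγP γγE := by unfold mapHess; positivity
  have hD' := devHess_scale_le hε0 hε1 hs hγU hγP hγE hγγU hγγP hγE' hγγE'
  have hGM : G' * mapGrad (ε * γU) (ε * γP) γE' ≤ (ε * G) * (ε * mapGrad γU γP γE) :=
    mul_le_mul hG' hM' hM'0 (by positivity)
  have hbH : b' * mapHess (ε * γU) (ε * γP) γE' (ε * γγU) (ε * γγP) γγE' ≤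
      (ε * b) * (ε * mapHess γU γP γE γγU γγP γγE) := mul_le_mul hb' hH' hH'0 (by positivity)
  have h1 : 0 ≤ G * mapGrad γU γP γE := by positivity
  have h2 : 0 ≤ b * mapHess γU γP γE γγU γγP γγE := by positivity
  unfold secondSrc
  nlinarith [hGM, hbH, hD', mul_le_mul_of_nonneg_right hε2 h1, mul_le_mul_of_nonneg_right hε2 h2]

/-- [folklore] (arith) `ε`-homogeneity of `secondFoot`. -/
theorem secondFoot_scale_le (hε0 : 0 ≤ ε) (hε1 : ε ≤ 1) (hb : 0 ≤ b) (hs : 0 ≤ s) (hq0 : 0 ≤ q₀) (hτ : 0 ≤ τ)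
    (hG : 0 ≤ G) (hγU : 0 ≤ γU) (hγP : 0 ≤ γP) (hb' : b' ≤ ε * b) (hG' : G' ≤ ε * G)
    (hγE' : γE' ≤ ε * γE) :
    secondFoot b' (ε * s) (ε * q₀) (ε * τ) G' (ε * γU) (ε * γP) γE' ≤
      ε * secondFoot b s q₀ τ G γU γP γE := by
  have hε2 := mul_self_le_of_unit hε0 hε1
  have h0 : 0 ≤ ε * (s + 2 * q₀ + 2 * τ) := by positivity
  have h1 : 0 ≤ G * (s + 2 * q₀ + 2 * τ) := by positivity
  have h2 : 0 ≤ 2 * (ε * γU) := by positivity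
  have h3 : 0 ≤ 2 * (ε * γP) := by positivity
  have h4 : 0 ≤ 2 * γU * (b + s) + γP * (2 * b + s) := by positivity
  unfold secondFoot
  nlinarith [mul_le_mul_of_nonneg_right hG' h0, mul_le_mul_of_nonneg_right hε2 h1,
    mul_le_mul_of_nonneg_left hb' h2, mul_le_mul_of_nonneg_left hb' h3, mul_le_mul_of_nonneg_right hε2 h4,
    hγE']

/-- [folklore] (arith) `ε`-homogeneity of `secondW`. -/
theorem secondW_scale_le (hε0 : 0 ≤ ε) (hε1 : ε ≤ 1) (hC : 0 ≤ C) (hs : 0 ≤ s) (hq0 : 0 ≤ q₀) (hτ : 0 ≤ τ)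
    (hG : 0 ≤ G) (hγU : 0 ≤ γU) (hγP : 0 ≤ γP) (hγE : 0 ≤ γE) (hγγU : 0 ≤ γγU) (hγγP : 0 ≤ γγP)
    (hγγE : 0 ≤ γγE) (hG' : G' ≤ ε * G) (hγE'0 : 0 ≤ γE') (hγE' : γE' ≤ ε * γE) (hγγE'0 : 0 ≤ γγE')
    (hγγE' : γγE' ≤ ε * γγE) :
    secondW C (ε * s) (ε * q₀) (ε * τ) G' (ε * γU) (ε * γP) γE' (ε * γγU) (ε * γγP) γγE' ≤
      ε * secondW C s q₀ τ G γU γP γE γγU γγP γγE := by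
  have hb' : C * (ε * s) ≤ ε * (C * s) := le_of_eq (by ring)
  have hF := secondFoot_scale_le (γE := γE) hε0 hε1 (mul_nonneg hC hs) hs hq0 hτ hG hγU hγP hb' hG' hγE'
  have hS := secondSrc_scale_le hε0 hε1 hs (mul_nonneg hC hs) hG hγU hγP hγE hγγU hγγP hγγE hb' hG' hγE'0 hγE'
    hγγE'0 hγγE'
  unfold secondW
  nlinarith [hF, mul_le_mul_of_nonneg_left hS hC]

/-- [folklore] (arith) `ε`-homogeneity of the second-difference bound `σ = secondDev`. -/
theorem secondDev_scale_le (hε0 : 0 ≤ ε) (hε1 : ε ≤ 1) (hC : 0 ≤ C) (hs : 0 ≤ s) (hq0 : 0 ≤ q₀) (hτ : 0 ≤ τ)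
    (hG : 0 ≤ G) (hγU : 0 ≤ γU) (hγP : 0 ≤ γP) (hγE : 0 ≤ γE) (hγγU : 0 ≤ γγU) (hγγP : 0 ≤ γγP)
    (hγγE : 0 ≤ γγE) (hG' : G' ≤ ε * G) (hγE'0 : 0 ≤ γE') (hγE' : γE' ≤ ε * γE) (hγγE'0 : 0 ≤ γγE')
    (hγγE' : γγE' ≤ ε * γγE) :
    secondDev C (ε * s) (ε * q₀) (ε * τ) G' (ε * γU) (ε * γP) γE' (ε * γγU) (ε * γγP) γγE' ≤
      ε * secondDev C s q₀ τ G γU γP γE γγU γγP γγE := by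
  have hε2 := mul_self_le_of_unit hε0 hε1
  have hW := secondW_scale_le hε0 hε1 hC hs hq0 hτ hG hγU hγP hγE hγγU hγγP hγγE hG' hγE'0 hγE' hγγE'0 hγγE'
  have h1 : 0 ≤ 2 * (ε * γU) := by positivity
  have h2 : 0 ≤ 2 * G * γU + C * s * γγU := by positivity
  unfold secondDev
  nlinarith [hW, mul_le_mul_of_nonneg_left hG' h1, mul_le_mul_of_nonneg_right hε2 h2]

/-- [folklore] The twelve letters scaled by `ε`. -/
def Letters.scale (ε : ℝ) (ℓ : Letters) : Letters :=
  ⟨ε * ℓ.s, ε * ℓ.q₀, ε * ℓ.q₁, ε * ℓ.τ₀, ε * ℓ.τ₁, ε * ℓ.γU, ε * ℓ.γU₁, ε * ℓ.γ₀, ε * ℓ.γ₁, ε * ℓ.γγU, ε * ℓ.γγP,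
    ε * ℓ.γγ₁⟩

/-- [folklore] Scaled nonnegative letters are nonnegative (`0 ≤ ε`). -/
theorem Letters.Nonneg.scale {ℓ : Letters} (hn : ℓ.Nonneg) (hε0 : 0 ≤ ε) : (ℓ.scale ε).Nonneg :=
  ⟨mul_nonneg hε0 hn.hs, mul_nonneg hε0 hn.hq₀, mul_nonneg hε0 hn.hq₁, mul_nonneg hε0 hn.hτ₀,
    mul_nonneg hε0 hn.hτ₁, mul_nonneg hε0 hn.hγU, mul_nonneg hε0 hn.hγU₁, mul_nonneg hε0 hn.hγ₀,
    mul_nonneg hε0 hn.hγ₁, mul_nonneg hε0 hn.hγγU, mul_nonneg hε0 hn.hγγP, mul_nonneg hε0 hn.hγγ₁⟩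

/-- **`ε`-HOMOGENEITY OF THE TELESCOPED ALL-RAW WINDOW** [folklore] (arith): for `0 ≤ ε ≤ 1`, `0 ≤ C` and
nonnegative letters, scaling the twelve letters by `ε` scales each of the three slots of `telWin C L β ℓ` by at most
`ε` — every monomial of `C·s`, `G_raw + C·s·γU` and `σ` has degree `≥ 1` in the letters and a nonnegative
coefficient (the lemmas `*_scale_le` above, bottom-up through `gradPoly`, `devGradPoly`, `gaugeStep`, `gaugeHess`,
`devHessPoly`, `mapGrad`, `mapHess`, `devHess`, `secondSrc`, `secondFoot`, `secondW`, `secondDev`). -/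
theorem telWin_scale_le {L : ℕ} {β : ℝ} {ℓ : Letters} (hε0 : 0 ≤ ε) (hε1 : ε ≤ 1) (hC : 0 ≤ C)
    (hn : ℓ.Nonneg) :
    (telWin C L β (ℓ.scale ε)).sup ≤ ε * (telWin C L β ℓ).sup ∧
      (telWin C L β (ℓ.scale ε)).grad ≤ ε * (telWin C L β ℓ).grad ∧
      (telWin C L β (ℓ.scale ε)).hol ≤ ε * (telWin C L β ℓ).hol := by
  obtain ⟨hs, hq₀, hq₁, hτ₀, hτ₁, hγU, hγU₁, hγ₀, hγ₁, hγγU, hγγP, hγγ₁⟩ := hn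
  have hε2 := mul_self_le_of_unit hε0 hε1
  have hG0 := gradPoly_nonneg hC hs hq₀ hq₁ hτ₀ hτ₁ hγU hγ₀ hγ₁
  have hG' := gradPoly_scale_le (γ₁ := ℓ.γ₁) hε0 hε1 hC hs hq₀ hq₁ hτ₀ hτ₁ hγU hγ₀
  have hG'0 := gradPoly_nonneg hC (mul_nonneg hε0 hs) (mul_nonneg hε0 hq₀) (mul_nonneg hε0 hq₁)
    (mul_nonneg hε0 hτ₀) (mul_nonneg hε0 hτ₁) (mul_nonneg hε0 hγU) (mul_nonneg hε0 hγ₀) (mul_nonneg hε0 hγ₁)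
    (C := C)
  have hE0 := devGradPoly_nonneg hC hs hq₁ hτ₀ hτ₁ hγ₀ hγ₁
  have hE' := devGradPoly_scale_le (γ₀ := ℓ.γ₀) (γ₁ := ℓ.γ₁) hε0 hε1 hC hs hq₁ hτ₀ hτ₁
  have hE'0 := devGradPoly_nonneg hC (mul_nonneg hε0 hs) (mul_nonneg hε0 hq₁) (mul_nonneg hε0 hτ₀)
    (mul_nonneg hε0 hτ₁) (mul_nonneg hε0 hγ₀) (mul_nonneg hε0 hγ₁) (C := C)
  have hH0 := devHessPoly_nonneg hC hs hq₁ hτ₀ hτ₁ hG0 hγU hγU₁ hγ₁ hγγP hγγ₁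
  have hH' := devHessPoly_scale_le (γγP := ℓ.γγP) (γγ₁ := ℓ.γγ₁) hε0 hε1 hC hs hq₁ hτ₀ hτ₁ hG0 hγU hγU₁ hγ₁ hG'
  have hH'0 := devHessPoly_nonneg hC (mul_nonneg hε0 hs) (mul_nonneg hε0 hq₁) (mul_nonneg hε0 hτ₀)
    (mul_nonneg hε0 hτ₁) hG'0 (mul_nonneg hε0 hγU) (mul_nonneg hε0 hγU₁) (mul_nonneg hε0 hγ₁)
    (mul_nonneg hε0 hγγP) (mul_nonneg hε0 hγγ₁)
  have hD := secondDev_scale_le hε0 hε1 hC hs hq₀ hτ₀ hG0 hγU hγ₀ hE0 hγγU hγγP hH0 hG' hE'0 hE' hH'0 hH'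
  have hL0 : (0 : ℝ) ≤ (L : ℝ) ^ (1 - β) := Real.rpow_nonneg (Nat.cast_nonneg L) _
  dsimp only [telWin, Letters.scale]
  refine ⟨le_of_eq (by ring), ?_, ?_⟩
  · have h1 : 0 ≤ C * ℓ.s * ℓ.γU := by positivity
    nlinarith [hG', mul_le_mul_of_nonneg_right hε2 h1]
  · exact (mul_le_mul_of_nonneg_left hD hL0).trans_eq (by ring)

/-- [folklore] (cell reading, NOT print) READING (A)'s DICTIONARY WITH THE SMALL-FIELD PARAMETER `ε`: a constant count
`C ≤ c` and the twelve letters `≤ ε·(dictionary of reading (A))` — `s, q₀, q₁, γU, γU₁ ≤ ε·cθ²`, `τ₀, τ₁ ≤ ε·cθ`,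
`γ₀, γ₁, γγU, γγP, γγ₁ ≤ ε·cθ^{2+β}`.  FORMAT of the common small factor of the three slots of
[Balaban1985RegularSpaces] (1.36) (`B₁(α₀+α₁)`, `B₂(β₀)(α₀+α₁)`) resp. of the one bound `α₂` of [Balaban1987RG1]
(3.31); NOT asserted for Bałaban's configurations.  `DictE θ 1 c β C ℓ ↔ DictA θ c β C ℓ` (`dictE_one_iff`). -/
structure DictE (θ ε c β C : ℝ) (ℓ : Letters) : Prop where
  count : C ≤ c
  dev : ℓ.s ≤ ε * (c * θ ^ 2)
  curv₀ : ℓ.q₀ ≤ ε * (c * θ ^ 2)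
  curv₁ : ℓ.q₁ ≤ ε * (c * θ ^ 2)
  bond₀ : ℓ.τ₀ ≤ ε * (c * θ)
  bond₁ : ℓ.τ₁ ≤ ε * (c * θ)
  gradU₀ : ℓ.γU ≤ ε * (c * θ ^ 2)
  gradU₁ : ℓ.γU₁ ≤ ε * (c * θ ^ 2)
  gradP₀ : ℓ.γ₀ ≤ ε * (c * θ ^ (2 + β))
  gradP₁ : ℓ.γ₁ ≤ ε * (c * θ ^ (2 + β))
  hessU₀ : ℓ.γγU ≤ ε * (c * θ ^ (2 + β))
  hessP₀ : ℓ.γγP ≤ ε * (c * θ ^ (2 + β))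
  hessP₁ : ℓ.γγ₁ ≤ ε * (c * θ ^ (2 + β))

/-- [folklore] At `ε = 1` the `ε`-dictionary is the dictionary of §1. -/
theorem dictE_one_iff {θ c β : ℝ} {ℓ : Letters} : DictE θ 1 c β C ℓ ↔ DictA θ c β C ℓ := by
  constructor
  · rintro ⟨h0, h1, h2, h3, h4, h5, h6, h7, h8, h9, h10, h11, h12⟩
    exact ⟨h0, by simpa using h1, by simpa using h2, by simpa using h3, by simpa using h4, by simpa using h5,
      by simpa using h6, by simpa using h7, by simpa using h8, by simpa using h9, by simpa using h10,
      by simpa using h11, by simpa using h12⟩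
  · rintro ⟨h0, h1, h2, h3, h4, h5, h6, h7, h8, h9, h10, h11, h12⟩
    exact ⟨h0, by simpa using h1, by simpa using h2, by simpa using h3, by simpa using h4, by simpa using h5,
      by simpa using h6, by simpa using h7, by simpa using h8, by simpa using h9, by simpa using h10,
      by simpa using h11, by simpa using h12⟩

/-- [folklore] (arith) Under the `ε`-dictionary the rescaled letters `ε⁻¹·ℓ` obey the dictionary of §1 and
`ℓ = ε·(ε⁻¹·ℓ)` (`0 < ε`). -/
theorem dictA_scale_inv {θ c β : ℝ} {ℓ : Letters} (hε : 0 < ε) (hD : DictE θ ε c β C ℓ) :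
    DictA θ c β C (ℓ.scale ε⁻¹) ∧ (ℓ.scale ε⁻¹).scale ε = ℓ := by
  have hk : ∀ {x y : ℝ}, x ≤ ε * y → ε⁻¹ * x ≤ y := fun {x y} h =>
    (mul_le_mul_of_nonneg_left h (inv_nonneg.2 hε.le)).trans_eq (inv_mul_cancel_left₀ hε.ne' y)
  have he : ∀ x : ℝ, ε * (ε⁻¹ * x) = x := fun x => mul_inv_cancel_left₀ hε.ne' x
  refine ⟨⟨hD.count, hk hD.dev, hk hD.curv₀, hk hD.curv₁, hk hD.bond₀, hk hD.bond₁, hk hD.gradU₀, hk hD.gradU₁,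
    hk hD.gradP₀, hk hD.gradP₁, hk hD.hessU₀, hk hD.hessP₀, hk hD.hessP₁⟩, ?_⟩
  ext <;> exact he _

/-- **THE UNIT-WEIGHT RATE WITH THE SMALL-FIELD PARAMETER** [folklore] (arith): `0 < ε ≤ 1`, `0 < θ ≤ 1 ≤ c`,
`0 ≤ β ≤ 1`, `0 ≤ C`, nonnegative letters obeying `DictE θ ε c β C ℓ`, block side `L ≤ Λ`, `1 ≤ Λ` ⟹
`N_{(1,1,1)}(telWin C L β ℓ) ≤ ε·sockConst c Λ·θ²` (§1's `winN_unit_telWin_le` for the rescaled letters `ε⁻¹·ℓ`,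
then `telWin_scale_le`). -/
theorem winN_unit_telWin_le_eps {L : ℕ} {θ c Λ β : ℝ} {ℓ : Letters} (hε : 0 < ε) (hε1 : ε ≤ 1) (hθ : 0 < θ)
    (hθ1 : θ ≤ 1) (hβ0 : 0 ≤ β) (hβ1 : β ≤ 1) (hc1 : 1 ≤ c) (hC0 : 0 ≤ C) (hΛ : 1 ≤ Λ) (hL : (L : ℝ) ≤ Λ)
    (hn : ℓ.Nonneg) (hD : DictE θ ε c β C ℓ) : winN unitWin (telWin C L β ℓ) ≤ ε * sockConst c Λ * θ ^ 2 := by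
  obtain ⟨hD', hℓ⟩ := dictA_scale_inv hε hD
  have hn' : (ℓ.scale ε⁻¹).Nonneg := hn.scale (inv_nonneg.2 hε.le)
  obtain ⟨h1, h2, h3⟩ := (winN_unitWin_le_iff).1 (winN_unit_telWin_le hθ hθ1 hβ0 hβ1 hc1 hC0 hΛ hL hn' hD')
  obtain ⟨e1, e2, e3⟩ := telWin_scale_le (L := L) (β := β) hε.le hε1 hC0 hn'
  rw [hℓ] at e1 e2 e3
  rw [winN_unitWin_le_iff]
  refine ⟨e1.trans ?_, e2.trans ?_, e3.trans ?_⟩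
  · exact (mul_le_mul_of_nonneg_left h1 hε.le).trans_eq (by ring)
  · exact (mul_le_mul_of_nonneg_left h2 hε.le).trans_eq (by ring)
  · exact (mul_le_mul_of_nonneg_left h3 hε.le).trans_eq (by ring)

end Eps

section EpsProducer

variable [NormOneClass R] {L : ℕ} {z : Site d}

/-- [folklore] THE PER-PAIR PRODUCER WITH THE SMALL-FIELD PARAMETER: raw sups + the `ε`-dictionary at `θ` ⟹ SOME window
data `b_w` of the comb-gauge block deviation with `N_{(1,1,1)}(b_w) ≤ ε·sockConst c Λ·θ²`. -/
theorem exists_windowData_unit_eps {U₀ U₁ : Cfg d R} {β θ ε c Λ : ℝ} {ℓ : Letters} (hε : 0 < ε) (hε1 : ε ≤ 1)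
    (hθ : 0 < θ) (hθ1 : θ ≤ 1) (hβ0 : 0 ≤ β) (hβ1 : β ≤ 1) (hc1 : 1 ≤ c) (hΛ : 1 ≤ Λ) (hL : (L : ℝ) ≤ Λ)
    (hC0 : 0 ≤ ((d : ℝ) - 1) * ((L : ℝ) - 1)) (h : RawSups L z U₀ U₁ ℓ)
    (hD : DictE θ ε c β (((d : ℝ) - 1) * ((L : ℝ) - 1)) ℓ) :
    ∃ bw : Win, WindowData L z β (blockDev L z (combGauge U₀ U₁ z) U₀ U₁) bw ∧
      winN unitWin bw ≤ ε * sockConst c Λ * θ ^ 2 :=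
  ⟨_, windowData_telWin hβ1 hC0 h, winN_unit_telWin_le_eps hε hε1 hθ hθ1 hβ0 hβ1 hc1 hC0 hΛ hL h.nonneg hD⟩

end EpsProducer

section EpsSocket

variable [NormOneClass R] [NormedAlgebra ℂ R] {F : Type*} [NormedAddCommGroup F] [NormedSpace ℂ F] [CompleteSpace F]
variable {B : Booking} {T : Trajectory B}

/-- **THE COMB-RAW FEED WITH THE SMALL-FIELD PARAMETER ⟹ `TransportsFrom`** [folklore] (= §3's
`transportsFrom_of_combRaw` with the dictionary `DictE … ε …` in the feed and the window hypothesis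
`ε·sockConst c Λ ≤ w`, `0 < ε ≤ 1`): `TransportsFrom (4·(ε·sockConst c Λ)/r) (ϑ²) Gate`.  With `w` of the size
of the printed window `α₂` this asks `ε ≤ α₂ / sockConst c Λ`-type smallness of the letters — FORMAT only, NOT asserted
for the cell's terms. -/
theorem transportsFrom_of_combRaw_eps {Gate : ℕ → Prop} {Fn : B.Birth → ℕ → Fld d R → F}
    {Lg : B.Birth → ℕ → ℕ} {zg : B.Birth → ℕ → Site d} {𝒦 : B.Birth → ℕ → Set (Fld d R)}
    {β : ℝ} {w r ε c Λ ϑ : ℝ}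
    (hinv : ∀ b k', GaugeInvariant (BlockRel (Lg b k') (zg b k')) (Fn b k'))
    (hsl : ∀ b k', BirthSlice (Fn b k') (wMove (Lg b k') (zg b k') β) (wN (Lg b k') (zg b k') β unitWin) (𝒦 b k')
      w r (T.gen b k'))
    (hr : 0 < r) (hε : 0 < ε) (hε1 : ε ≤ 1) (hβ0 : 0 ≤ β) (hβ1 : β ≤ 1) (hc1 : 1 ≤ c) (hΛ : 1 ≤ Λ) (hϑ : 0 < ϑ)
    (hϑ1 : ϑ ≤ 1) (hw : ε * sockConst c Λ ≤ w) (hL : ∀ b k', (Lg b k' : ℝ) ≤ Λ)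
    (hCnn : ∀ b k', 0 ≤ ((d : ℝ) - 1) * ((Lg b k' : ℝ) - 1))
    (hCc : ∀ b k', ((d : ℝ) - 1) * ((Lg b k' : ℝ) - 1) ≤ c)
    (hfeed : ∀ (b : B.Birth) (k' k : ℕ), B.birthScale b ≤ k' → k' ≤ k → k ≤ B.K → RanBelow Gate k → ∀ ε' > 0,
      ∃ U₀ U₁ : Cfg d R, ∃ ℓ : Letters, val U₀ ∈ 𝒦 b k' ∧ RawSups (Lg b k') (zg b k') U₀ U₁ ℓ ∧
        DictE (ϑ ^ (k - k')) ε c β (((d : ℝ) - 1) * ((Lg b k' : ℝ) - 1)) ℓ ∧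
        T.lin b k' k ≤ ‖Fn b k' (val U₁) - Fn b k' (val U₀)‖ + ε') :
    T.TransportsFrom (4 * (ε * sockConst c Λ) / r) (ϑ ^ 2) Gate := by
  have hΛ0 : 0 ≤ Λ := zero_le_one.trans hΛ
  have hcδ : 0 ≤ ε * sockConst c Λ := mul_nonneg hε.le (sockConst_nonneg (zero_le_one.trans hc1) hΛ0)
  refine transportsFrom_of_window hinv hsl unitWin_pos hr (pow_nonneg hϑ.le 2) (pow_le_one₀ hϑ.le hϑ1) hcδ hw ?_
  intro b k' k hbk' hk'k hk hran ε' hε'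
  obtain ⟨U₀, U₁, ℓ, hU₀𝒦, hR, hD, hle⟩ := hfeed b k' k hbk' hk'k hk hran ε' hε'
  have hθ : 0 < ϑ ^ (k - k') := pow_pos hϑ _
  have hθ1 : ϑ ^ (k - k') ≤ 1 := pow_le_one₀ hϑ.le hϑ1
  obtain ⟨bw, hW, hbw⟩ := exists_windowData_unit_eps hε hε1 hθ hθ1 hβ0 hβ1 hc1 hΛ (hL b k') (hCnn b k') hR
    ⟨(hCc b k'), hD.dev, hD.curv₀, hD.curv₁, hD.bond₀, hD.bond₁, hD.gradU₀, hD.gradU₁, hD.gradP₀, hD.gradP₁,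
      hD.hessU₀, hD.hessP₀, hD.hessP₁⟩
  refine ⟨U₀, U₁, combGauge U₀ U₁ (zg b k'), bw, hU₀𝒦, unitaryLike_combGauge hR.unit₀ hR.unit₁ _, hW, ?_, hle⟩
  calc winN unitWin bw ≤ ε * sockConst c Λ * (ϑ ^ (k - k')) ^ 2 := hbw
    _ = ε * sockConst c Λ * (ϑ ^ 2) ^ (k - k') := by rw [← pow_mul, ← pow_mul, Nat.mul_comm]

/-- **END TO END WITH THE COMB-RAW `ε`-FEED (strict product, bounded weights — K-UNIFORM)** [folklore] (= §3's
`latticeTrajectory_budget_combRaw_strict` with the `ε`-dictionary: any `C ≥ 4·(ε·sockConst c Λ)/r`).  NOT asserted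
for the cell's terms. -/
theorem latticeTrajectory_budget_combRaw_eps_strict {Fn : B.Birth → ℕ → Fld d R → F}
    {Lg : B.Birth → ℕ → ℕ} {zg : B.Birth → ℕ → Site d} {𝒦 : B.Birth → ℕ → Set (Fld d R)}
    {β : ℝ} {w r ε c Λ ϑ : ℝ} {N : ℕ → ℕ → ℝ} {wt : ℕ → ℝ} {N₀ Λc wbar C cR Ahat τ r' : ℝ} {H : ℕ → Prop}
    (hinv : ∀ b k', GaugeInvariant (BlockRel (Lg b k') (zg b k')) (Fn b k'))
    (hsl : ∀ b k', BirthSlice (Fn b k') (wMove (Lg b k') (zg b k') β) (wN (Lg b k') (zg b k') β unitWin) (𝒦 b k')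
      w r (T.gen b k'))
    (hr : 0 < r) (hε : 0 < ε) (hε1 : ε ≤ 1) (hβ0 : 0 ≤ β) (hβ1 : β ≤ 1) (hc1 : 1 ≤ c) (hΛ : 1 ≤ Λ) (hϑ : 0 < ϑ)
    (hϑ1 : ϑ ≤ 1) (hww : ε * sockConst c Λ ≤ w) (hL : ∀ b k', (Lg b k' : ℝ) ≤ Λ)
    (hCnn : ∀ b k', 0 ≤ ((d : ℝ) - 1) * ((Lg b k' : ℝ) - 1))
    (hCc : ∀ b k', ((d : ℝ) - 1) * ((Lg b k' : ℝ) - 1) ≤ c) (hCle : 4 * (ε * sockConst c Λ) / r ≤ C)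
    (hfeed : ∀ (b : B.Birth) (k' k : ℕ), B.birthScale b ≤ k' → k' ≤ k → k ≤ B.K →
      RanBelow (fun i => CubeBudgetAt B wt ((N₀ * (C * Ahat)) * wbar * (1 - r')⁻¹) i ∧ H i) k → ∀ ε' > 0,
      ∃ U₀ U₁ : Cfg d R, ∃ ℓ : Letters, val U₀ ∈ 𝒦 b k' ∧ RawSups (Lg b k') (zg b k') U₀ U₁ ℓ ∧
        DictE (ϑ ^ (k - k')) ε c β (((d : ℝ) - 1) * ((Lg b k' : ℝ) - 1)) ℓ ∧
        T.lin b k' k ≤ ‖Fn b k' (val U₁) - Fn b k' (val U₀)‖ + ε')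
    (hw : ∀ j, j ≤ B.K → 0 ≤ wt j) (hwb : ∀ j, j ≤ B.K → wt j ≤ wbar) (hN : B.PositionalCount N)
    (hNle : ∀ j k, j ≤ k → k ≤ B.K → N j k ≤ N₀ * Λc ^ (k - j)) (hN₀ : 0 ≤ N₀) (hΛc : 0 ≤ Λc)
    (hcR : 0 ≤ cR) (hAhat : 0 ≤ Ahat) (hτ0 : 0 ≤ τ) (hτ1 : τ ≤ 1)
    (hprod : Λc * (ϑ ^ 2 + C * cR) * τ ≤ r') (hr'1 : r' < 1) (h0 : T.BirthGen Ahat τ)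
    (hreg : T.RegeneratesFrom cR (fun k => CubeBudgetAt B wt ((N₀ * (C * Ahat)) * wbar * (1 - r')⁻¹) k ∧ H k))
    (hH : GateOfSizes B (twoRate B.K (C * Ahat) (ϑ ^ 2 + C * cR) τ) H) :
    B.SizeBound (twoRate B.K (C * Ahat) (ϑ ^ 2 + C * cR) τ) ∧
      B.CubeBudget wt ((N₀ * (C * Ahat)) * wbar * (1 - r')⁻¹) ∧ ∀ k, k ≤ B.K → H k := by
  have hΛ0 : 0 ≤ Λ := zero_le_one.trans hΛ
  have hψ : (0 : ℝ) ≤ ϑ ^ 2 := pow_nonneg hϑ.le 2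
  have hC0 : 0 ≤ 4 * (ε * sockConst c Λ) / r :=
    div_nonneg (mul_nonneg (by norm_num) (mul_nonneg hε.le (sockConst_nonneg (zero_le_one.trans hc1) hΛ0))) hr.le
  have hCC : 0 ≤ C := hC0.trans hCle
  have htr := (transportsFrom_of_combRaw_eps hinv hsl hr hε hε1 hβ0 hβ1 hc1 hΛ hϑ hϑ1 hww hL hCnn hCc hfeed).mono
    hCle hψ le_rfl hCC
  exact Trajectory.sizeBound_cubeBudget_of_trajectory_strict hw hwb hN hNle hN₀ hΛc hCC hψ hcR hAhat hτ0 hτ1 hprod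
    hr'1 h0 htr hreg hH

end EpsSocket

section EpsWitness

/-- [folklore] The zero letters obey the `ε`-dictionary for any `0 ≤ ε`, `0 < θ`, `0 ≤ c`, `C ≤ c`. -/
theorem dictE_zero {θ ε c β C : ℝ} (hε : 0 ≤ ε) (hθ : 0 < θ) (hc : 0 ≤ c) (hC : C ≤ c) :
    DictE θ ε c β C Letters.zero := by
  have h2 : (0 : ℝ) ≤ ε * (c * θ ^ 2) := by positivity
  have h1 : (0 : ℝ) ≤ ε * (c * θ) := by positivity
  have hr : (0 : ℝ) ≤ ε * (c * θ ^ (2 + β)) := mul_nonneg hε (mul_nonneg hc (Real.rpow_nonneg hθ.le _))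
  exact ⟨hC, h2, h2, h2, h1, h1, h2, h2, hr, hr, hr, hr, hr⟩

/-- [folklore] NON-VACUITY of the `ε`-feed's per-pair content: the flat pair over `ℝ` has window data of its (trivial)
comb-gauge deviation inside the unit-weight window at the rate `ε·sockConst c Λ·θ²` for every `0 < ε ≤ 1`,
`0 < θ ≤ 1 ≤ c`, `0 ≤ β ≤ 1`, `L ≤ Λ`, `0 ≤ (d−1)(L−1) ≤ c`. -/
example (d L : ℕ) (z : Site d) {β θ ε c Λ : ℝ} (hε : 0 < ε) (hε1 : ε ≤ 1) (hθ : 0 < θ) (hθ1 : θ ≤ 1)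
    (hβ0 : 0 ≤ β) (hβ1 : β ≤ 1) (hc1 : 1 ≤ c) (hΛ : 1 ≤ Λ) (hL : (L : ℝ) ≤ Λ)
    (hC0 : 0 ≤ ((d : ℝ) - 1) * ((L : ℝ) - 1)) (hC : ((d : ℝ) - 1) * ((L : ℝ) - 1) ≤ c) :
    ∃ bw : Win, WindowData L z β (blockDev L z (combGauge (fun _ _ => (1 : ℝˣ)) (fun _ _ => 1) z)
      (fun _ _ => (1 : ℝˣ)) (fun _ _ => 1)) bw ∧ winN unitWin bw ≤ ε * sockConst c Λ * θ ^ 2 :=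
  exists_windowData_unit_eps hε hε1 hθ hθ1 hβ0 hβ1 hc1 hΛ hL hC0 (rawSups_flat d L z)
    (dictE_zero hε.le hθ (zero_le_one.trans hc1) hC)

end EpsWitness

/-! ## §6  (v1.2) LETTER REDUCTION: the unit-weight socket from SEVEN raw letters at INTEGER rates

Five of the twelve letters — `γ₀, γ₁` (plain plaquette gradients), `γγU` (bond second differences), `γγP, γγ₁`
(plaquette second differences) — are bounded on a block by the plain bond gradients `γU, γU₁` of a unitary-like pair
(§6.1), and the unit-weight rate of §1 needs the dictionary only at rate exponent `0` (§6.2); so the socket of §5 runs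
on the seven letters `s, q₀, q₁, τ₀, τ₁, γU, γU₁` at integer rates (§6.3–§6.5).  APPEND-ONLY: §§1–5 are unchanged and
used by name. -/

open T4RelativeLadder (norm_mul_unit_le norm_unit_mul_le norm_inv_sub_inv_le)
open T4CombSecondRaw (e_nonneg inBlock_of_le_of_le gradPoly_le_rateA secondDev_allRaw_le_rateA)

/-! ### §6.1  [folklore] Plaquette gradients and second differences from bond gradients -/

section Reduction

variable {L : ℕ} {z : Site d}

omit [NormedRing R] in
/-- [folklore] The six corners of the box `x + {0, e_μ} + {0, e_ρ} + {0, e_α}` strictly between `x` and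
`x + e_μ + e_ρ + e_α` lie in the block when the two extreme corners do (`T4CombSecondRaw.inBlock_of_le_of_le`). -/
theorem inBlock_box₃ {x : Site d} {μ ρ α : Fin d} (hx : InBlock L z x) (hw : InBlock L z (x + e μ + e ρ + e α)) :
    InBlock L z (x + e μ) ∧ InBlock L z (x + e ρ) ∧ InBlock L z (x + e α) ∧ InBlock L z (x + e μ + e ρ) ∧
      InBlock L z (x + e μ + e α) ∧ InBlock L z (x + e ρ + e α) := by
  have H : ∀ p : Site d, (∀ κ, x κ ≤ p κ ∧ p κ ≤ (x + e μ + e ρ + e α) κ) → InBlock L z p :=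
    fun p hp => inBlock_of_le_of_le hx hw p hp
  refine ⟨H _ ?_, H _ ?_, H _ ?_, H _ ?_, H _ ?_, H _ ?_⟩ <;> intro κ <;> simp only [Pi.add_apply] <;>
    constructor <;> linarith [e_nonneg (d := d) μ κ, e_nonneg (d := d) ρ κ, e_nonneg (d := d) α κ]

omit [NormedRing R] in
/-- [folklore] The corners of the box `y + {0, e_μ} + {0, e_ρ} + {0, e_α} + {0, e_ν}` lie in the block when `y` and
`y + e_μ + e_ρ + e_α + e_ν` do (fourteen corners, four of them also in a second summation order). -/
theorem inBlock_box₄ {y : Site d} {μ ρ α ν : Fin d} (hy : InBlock L z y)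
    (hw : InBlock L z (y + e μ + e ρ + e α + e ν)) :
    InBlock L z (y + e μ) ∧ InBlock L z (y + e ρ) ∧ InBlock L z (y + e α) ∧ InBlock L z (y + e ν) ∧
      InBlock L z (y + e μ + e ρ) ∧ InBlock L z (y + e μ + e α) ∧ InBlock L z (y + e μ + e ν) ∧
      InBlock L z (y + e ρ + e α) ∧ InBlock L z (y + e ρ + e ν) ∧ InBlock L z (y + e α + e ν) ∧
      InBlock L z (y + e μ + e ρ + e α) ∧ InBlock L z (y + e μ + e ρ + e ν) ∧
      InBlock L z (y + e μ + e α + e ν) ∧ InBlock L z (y + e ρ + e α + e ν) ∧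
      InBlock L z (y + e ν + e α) ∧ InBlock L z (y + e μ + e ν + e α) ∧
      InBlock L z (y + e ρ + e ν + e α) ∧ InBlock L z (y + e μ + e ρ + e ν + e α) := by
  have H : ∀ p : Site d, (∀ κ, y κ ≤ p κ ∧ p κ ≤ (y + e μ + e ρ + e α + e ν) κ) → InBlock L z p :=
    fun p hp => inBlock_of_le_of_le hy hw p hp
  refine ⟨H _ ?_, H _ ?_, H _ ?_, H _ ?_, H _ ?_, H _ ?_, H _ ?_, H _ ?_, H _ ?_, H _ ?_, H _ ?_, H _ ?_,
    H _ ?_, H _ ?_, H _ ?_, H _ ?_, H _ ?_, H _ ?_⟩ <;> intro κ <;> simp only [Pi.add_apply] <;>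
    constructor <;>
    linarith [e_nonneg (d := d) μ κ, e_nonneg (d := d) ρ κ, e_nonneg (d := d) α κ, e_nonneg (d := d) ν κ]

/-- [folklore] FOUR-LETTER WORDS: `‖a·b·c⁻¹·d⁻¹ − a′·b′·c′⁻¹·d′⁻¹‖ ≤ ‖a − a′‖ + ‖b − b′‖ + ‖c − c′‖ + ‖d − d′‖` for
unitary-like units (telescoping; `‖c⁻¹ − c′⁻¹‖ ≤ ‖c − c′‖`, `T4RelativeLadder.norm_inv_sub_inv_le`). -/
theorem norm_word₄_sub_le {a b c d₀ a' b' c' d' : Rˣ} (hb : UnitaryLike b) (hc : UnitaryLike c)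
    (hd : UnitaryLike d₀) (ha' : UnitaryLike a') (hb' : UnitaryLike b') (hc' : UnitaryLike c')
    (hd' : UnitaryLike d') :
    ‖(a : R) * b * ((c⁻¹ : Rˣ) : R) * ((d₀⁻¹ : Rˣ) : R) - (a' : R) * b' * ((c'⁻¹ : Rˣ) : R) * ((d'⁻¹ : Rˣ) : R)‖ ≤
      ‖(a : R) - a'‖ + ‖(b : R) - b'‖ + ‖(c : R) - c'‖ + ‖(d₀ : R) - d'‖ := by
  have e₁ : (a : R) * b * ((c⁻¹ : Rˣ) : R) * ((d₀⁻¹ : Rˣ) : R) -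
        (a' : R) * b' * ((c'⁻¹ : Rˣ) : R) * ((d'⁻¹ : Rˣ) : R) =
      ((a : R) - a') * b * ((c⁻¹ : Rˣ) : R) * ((d₀⁻¹ : Rˣ) : R) +
        (a' : R) * ((b : R) - b') * ((c⁻¹ : Rˣ) : R) * ((d₀⁻¹ : Rˣ) : R) +
        (a' : R) * b' * (((c⁻¹ : Rˣ) : R) - ((c'⁻¹ : Rˣ) : R)) * ((d₀⁻¹ : Rˣ) : R) +
        (a' : R) * b' * ((c'⁻¹ : Rˣ) : R) * (((d₀⁻¹ : Rˣ) : R) - ((d'⁻¹ : Rˣ) : R)) := by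
    simp only [mul_sub, sub_mul]; abel
  rw [e₁]
  have t1 : ‖((a : R) - a') * b * ((c⁻¹ : Rˣ) : R) * ((d₀⁻¹ : Rˣ) : R)‖ ≤ ‖(a : R) - a'‖ :=
    (norm_mul_unit_le hd.inv _).trans ((norm_mul_unit_le hc.inv _).trans (norm_mul_unit_le hb _))
  have t2 : ‖(a' : R) * ((b : R) - b') * ((c⁻¹ : Rˣ) : R) * ((d₀⁻¹ : Rˣ) : R)‖ ≤ ‖(b : R) - b'‖ :=
    (norm_mul_unit_le hd.inv _).trans ((norm_mul_unit_le hc.inv _).trans (norm_unit_mul_le ha' _))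
  have t3 : ‖(a' : R) * b' * (((c⁻¹ : Rˣ) : R) - ((c'⁻¹ : Rˣ) : R)) * ((d₀⁻¹ : Rˣ) : R)‖ ≤ ‖(c : R) - c'‖ := by
    refine (norm_mul_unit_le hd.inv _).trans ?_
    rw [mul_assoc]
    exact (norm_unit_mul_le ha' _).trans ((norm_unit_mul_le hb' _).trans (norm_inv_sub_inv_le hc hc'))
  have t4 : ‖(a' : R) * b' * ((c'⁻¹ : Rˣ) : R) * (((d₀⁻¹ : Rˣ) : R) - ((d'⁻¹ : Rˣ) : R))‖ ≤ ‖(d₀ : R) - d'‖ := by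
    rw [mul_assoc, mul_assoc]
    exact (norm_unit_mul_le ha' _).trans ((norm_unit_mul_le hb' _).trans
      ((norm_unit_mul_le hc'.inv _).trans (norm_inv_sub_inv_le hd hd')))
  exact (norm_add_le _ _).trans (add_le_add ((norm_add_le _ _).trans (add_le_add ((norm_add_le _ _).trans
    (add_le_add t1 t2)) t3)) t4)

/-- [folklore] A DIFFERENCE OF TWO BASED PLAQUETTE VARIABLES of a unitary-like configuration is bounded by the four
differences of their bond variables (`norm_word₄_sub_le` on `T4RelativeComb.plaq`; no relation between the two base
points is needed). -/
theorem norm_plaq_sub_plaq_le {U : Cfg d R} (hU : ∀ x ν, UnitaryLike (U x ν)) (p q : Site d) (ρ ν : Fin d) :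
    ‖(plaq U q ρ ν : R) - plaq U p ρ ν‖ ≤ ‖(U q ρ : R) - U p ρ‖ + ‖(U (q + e ρ) ν : R) - U (p + e ρ) ν‖ +
      ‖(U (q + e ν) ρ : R) - U (p + e ν) ρ‖ + ‖(U q ν : R) - U p ν‖ := by
  simp only [plaq, Units.val_mul]
  exact norm_word₄_sub_le (hU _ _) (hU _ _) (hU _ _) (hU _ _) (hU _ _) (hU _ _) (hU _ _)

/-- [folklore] The four-corner bond-gradient sup read with the shifted site given up to an equation of sites. -/
theorem bondGrad_of_eq {U : Cfg d R} {γ : ℝ}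
    (hγ : ∀ μ x ρ, InBlock L z x → InBlock L z (x + e ρ) → InBlock L z (x + e μ) →
      InBlock L z (x + e μ + e ρ) → ‖(U (x + e μ) ρ : R) - U x ρ‖ ≤ γ)
    (p q : Site d) (ρ : Fin d) {μ : Fin d} (hq : q = p + e μ) (h₁ : InBlock L z p) (h₂ : InBlock L z (p + e ρ))
    (h₃ : InBlock L z q) (h₄ : InBlock L z (q + e ρ)) : ‖(U q ρ : R) - U p ρ‖ ≤ γ := by
  subst hq; exact hγ μ p ρ h₁ h₂ h₃ h₄

/-- **PLAIN PLAQUETTE GRADIENT ≤ 4 · PLAIN BOND GRADIENT** [folklore]: on a block, a four-corner sup `γ` of the plain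
bond gradients of a unitary-like configuration bounds its eight-corner plain plaquette gradients by `4γ` (the
plaquette word has four bonds, `norm_plaq_sub_plaq_le`; every bond square involved has its four corners among the
eight hypothesis corners). -/
theorem plaqGrad_le_of_bondGrad {U : Cfg d R} {γ : ℝ} (hU : ∀ x ν, UnitaryLike (U x ν))
    (hγ : ∀ μ x ρ, InBlock L z x → InBlock L z (x + e ρ) → InBlock L z (x + e μ) →
      InBlock L z (x + e μ + e ρ) → ‖(U (x + e μ) ρ : R) - U x ρ‖ ≤ γ) :
    ∀ μ y ρ ν', ρ ≠ ν' → InBlock L z y → InBlock L z (y + e ρ) → InBlock L z (y + e ν') →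
      InBlock L z (y + e ρ + e ν') → InBlock L z (y + e μ) → InBlock L z (y + e μ + e ρ) →
      InBlock L z (y + e μ + e ν') → InBlock L z (y + e μ + e ρ + e ν') →
      ‖(plaq U (y + e μ) ρ ν' : R) - plaq U y ρ ν'‖ ≤ 4 * γ := by
  intro μ y ρ ν' _ hy hρ hν hρν hμ hμρ hμν hμρν
  have b1 := bondGrad_of_eq hγ y (y + e μ) ρ rfl hy hρ hμ hμρ
  have b2 := bondGrad_of_eq hγ (y + e ρ) (y + e μ + e ρ) ν' (add_right_comm y (e μ) (e ρ)) hρ hρν hμρ hμρν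
  have b3 := bondGrad_of_eq hγ (y + e ν') (y + e μ + e ν') ρ (add_right_comm y (e μ) (e ν')) hν
    (add_right_comm y (e ρ) (e ν') ▸ hρν) hμν (add_right_comm (y + e μ) (e ρ) (e ν') ▸ hμρν)
  have b4 := bondGrad_of_eq hγ y (y + e μ) ν' rfl hy hν hμ hμν
  exact (norm_plaq_sub_plaq_le hU y (y + e μ) ρ ν').trans (by linarith)

/-- **PLAIN BOND SECOND DIFFERENCE ≤ 2 · PLAIN BOND GRADIENT** [folklore]: the mixed second difference over
`x, x+e_μ, x+e_ρ, x+e_μ+e_ρ` of the bond variables in direction `α` is a difference of two first differences; the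
corners needed lie between `x` and `x + e_μ + e_ρ + e_α` (`inBlock_box₃`). -/
theorem bondHess_le_of_bondGrad {U : Cfg d R} {γ : ℝ}
    (hγ : ∀ μ x ρ, InBlock L z x → InBlock L z (x + e ρ) → InBlock L z (x + e μ) →
      InBlock L z (x + e μ + e ρ) → ‖(U (x + e μ) ρ : R) - U x ρ‖ ≤ γ) :
    ∀ μ ρ x α, InBlock L z x → InBlock L z (x + e μ + e ρ + e α) →
      ‖(U (x + e μ + e ρ) α : R) - U (x + e μ) α - U (x + e ρ) α + U x α‖ ≤ 2 * γ := by
  intro μ ρ x α hx hw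
  obtain ⟨hμ, hρ, hα, hμρ, hμα, hρα⟩ := inBlock_box₃ hx hw
  have b1 := bondGrad_of_eq hγ (x + e ρ) (x + e μ + e ρ) α (add_right_comm x (e μ) (e ρ)) hρ hρα hμρ hw
  have b2 := bondGrad_of_eq hγ x (x + e μ) α rfl hx hα hμ hμα
  calc ‖(U (x + e μ + e ρ) α : R) - U (x + e μ) α - U (x + e ρ) α + U x α‖
      = ‖((U (x + e μ + e ρ) α : R) - U (x + e ρ) α) - ((U (x + e μ) α : R) - U x α)‖ := by
        congr 1; abel
    _ ≤ γ + γ := (norm_sub_le _ _).trans (add_le_add b1 b2)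
    _ = 2 * γ := by ring

/-- **PLAIN PLAQUETTE SECOND DIFFERENCE ≤ 8 · PLAIN BOND GRADIENT** [folklore]: the mixed second difference of the
based plaquettes `(·; α, ν′)` over `y, y+e_μ, y+e_ρ, y+e_μ+e_ρ` is a difference of two plaquette gradients, each
bounded by four bond gradients whose corners lie between `y` and `y + e_μ + e_ρ + e_α + e_ν′` (`inBlock_box₄`). -/
theorem plaqHess_le_of_bondGrad {U : Cfg d R} {γ : ℝ} (hU : ∀ x ν, UnitaryLike (U x ν))
    (hγ : ∀ μ x ρ, InBlock L z x → InBlock L z (x + e ρ) → InBlock L z (x + e μ) →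
      InBlock L z (x + e μ + e ρ) → ‖(U (x + e μ) ρ : R) - U x ρ‖ ≤ γ) :
    ∀ μ ρ y α ν', α ≠ ν' → InBlock L z y → InBlock L z (y + e μ + e ρ + e α + e ν') →
      ‖(plaq U (y + e μ + e ρ) α ν' : R) - plaq U (y + e μ) α ν' - plaq U (y + e ρ) α ν' +
          plaq U y α ν'‖ ≤ 8 * γ := by
  intro μ ρ y α ν' _ hy hw
  obtain ⟨h1, h2, h3, h4, h5, h6, h7, h8, h9, h10, h11, h12, h13, h14, h15, h16, h17, h18⟩ :=
    inBlock_box₄ hy hw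
  have b1 := bondGrad_of_eq hγ (y + e ρ) (y + e μ + e ρ) α (add_right_comm y (e μ) (e ρ)) h2 h8 h5 h11
  have b2 := bondGrad_of_eq hγ (y + e ρ + e α) (y + e μ + e ρ + e α) ν' (by abel) h8 h14 h11 hw
  have b3 := bondGrad_of_eq hγ (y + e ρ + e ν') (y + e μ + e ρ + e ν') α (by abel) h9 h17 h12 h18
  have b4 := bondGrad_of_eq hγ (y + e ρ) (y + e μ + e ρ) ν' (add_right_comm y (e μ) (e ρ)) h2 h9 h5 h12
  have b5 := bondGrad_of_eq hγ y (y + e μ) α rfl hy h3 h1 h6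
  have b6 := bondGrad_of_eq hγ (y + e α) (y + e μ + e α) ν' (add_right_comm y (e μ) (e α)) h3 h10 h6 h13
  have b7 := bondGrad_of_eq hγ (y + e ν') (y + e μ + e ν') α (add_right_comm y (e μ) (e ν')) h4 h15 h7 h16
  have b8 := bondGrad_of_eq hγ y (y + e μ) ν' rfl hy h4 h1 h7
  have hA := norm_plaq_sub_plaq_le hU (y + e ρ) (y + e μ + e ρ) α ν'
  have hB := norm_plaq_sub_plaq_le hU y (y + e μ) α ν'
  calc ‖(plaq U (y + e μ + e ρ) α ν' : R) - plaq U (y + e μ) α ν' - plaq U (y + e ρ) α ν' + plaq U y α ν'‖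
      = ‖((plaq U (y + e μ + e ρ) α ν' : R) - plaq U (y + e ρ) α ν') -
          ((plaq U (y + e μ) α ν' : R) - plaq U y α ν')‖ := by
        congr 1; abel
    _ ≤ _ := norm_sub_le _ _
    _ ≤ 8 * γ := by linarith

/-- [folklore] THE SEVEN FIRST-ORDER RAW LETTERS: gauge-fixed relative plaquette deviation `s`, curvatures `q₀, q₁`,
bond deviations `τ₀, τ₁`, plain bond gradients `γU, γU₁` (the letters of `Letters` of order `≤ 1` in lattice
differences of the bond variables; the five letters `γ₀, γ₁, γγU, γγP, γγ₁` are DERIVED from `γU, γU₁`,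
`Letters₇.lift`). -/
@[ext] structure Letters₇ where
  /-- gauge-fixed relative plaquette deviation sup -/
  s : ℝ
  /-- curvature sup of `U₀` -/
  q₀ : ℝ
  /-- curvature sup of `U₁` -/
  q₁ : ℝ
  /-- bond deviation sup of `U₀` -/
  τ₀ : ℝ
  /-- bond deviation sup of `U₁` -/
  τ₁ : ℝ
  /-- plain bond gradient sup of `U₀` -/
  γU : ℝ
  /-- plain bond gradient sup of `U₁` -/
  γU₁ : ℝ

/-- [folklore] All seven letters nonnegative. -/
structure Letters₇.Nonneg (ℓ : Letters₇) : Prop where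
  hs : 0 ≤ ℓ.s
  hq₀ : 0 ≤ ℓ.q₀
  hq₁ : 0 ≤ ℓ.q₁
  hτ₀ : 0 ≤ ℓ.τ₀
  hτ₁ : 0 ≤ ℓ.τ₁
  hγU : 0 ≤ ℓ.γU
  hγU₁ : 0 ≤ ℓ.γU₁

/-- [folklore] THE DERIVED TWELVE LETTERS: `γ₀ := 4γU`, `γ₁ := 4γU₁` (`plaqGrad_le_of_bondGrad`), `γγU := 2γU`
(`bondHess_le_of_bondGrad`), `γγP := 8γU`, `γγ₁ := 8γU₁` (`plaqHess_le_of_bondGrad`). -/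
def Letters₇.lift (ℓ : Letters₇) : Letters :=
  ⟨ℓ.s, ℓ.q₀, ℓ.q₁, ℓ.τ₀, ℓ.τ₁, ℓ.γU, ℓ.γU₁, 4 * ℓ.γU, 4 * ℓ.γU₁, 2 * ℓ.γU, 8 * ℓ.γU, 8 * ℓ.γU₁⟩

/-- [folklore] The seven first-order letters of twelve letters (the other five forgotten). -/
def Letters.drop (ℓ : Letters) : Letters₇ := ⟨ℓ.s, ℓ.q₀, ℓ.q₁, ℓ.τ₀, ℓ.τ₁, ℓ.γU, ℓ.γU₁⟩

/-- [folklore] The derived twelve letters of nonnegative seven letters are nonnegative. -/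
theorem Letters₇.Nonneg.lift {ℓ : Letters₇} (h : ℓ.Nonneg) : ℓ.lift.Nonneg :=
  ⟨h.hs, h.hq₀, h.hq₁, h.hτ₀, h.hτ₁, h.hγU, h.hγU₁, mul_nonneg (by norm_num) h.hγU,
    mul_nonneg (by norm_num) h.hγU₁, mul_nonneg (by norm_num) h.hγU, mul_nonneg (by norm_num) h.hγU,
    mul_nonneg (by norm_num) h.hγU₁⟩

/-- [folklore] THE SEVEN RAW BLOCK SUPS of a pair `(U₀, U₁)` on the block `B(z)` of side `L`: the fields `unit₀`,
`unit₁`, `dev`, `curv₀`, `curv₁`, `bond₀`, `bond₁`, `gradU₀`, `gradU₁` of `RawSups` VERBATIM (the five fields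
`gradP₀`, `gradP₁`, `hessU₀`, `hessP₀`, `hessP₁` DELETED) and the seven letters `≥ 0`. -/
structure RawSups₇ (L : ℕ) (z : Site d) (U₀ U₁ : Cfg d R) (ℓ : Letters₇) : Prop where
  unit₀ : ∀ x ν, UnitaryLike (U₀ x ν)
  unit₁ : ∀ x ν, UnitaryLike (U₁ x ν)
  dev : PlaqSup L z (fun y ρ ν => ‖(plaq (gaugeAct (combGauge U₀ U₁ z) U₁) y ρ ν : R) - plaq U₀ y ρ ν‖) ℓ.s
  curv₀ : PlaqSup L z (fun y ρ ν => ‖(plaq U₀ y ρ ν : R) - 1‖) ℓ.q₀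
  curv₁ : PlaqSup L z (fun y ρ ν => ‖(plaq U₁ y ρ ν : R) - 1‖) ℓ.q₁
  bond₀ : ∀ x ρ, InBlock L z x → InBlock L z (x + e ρ) → ‖(U₀ x ρ : R) - 1‖ ≤ ℓ.τ₀
  bond₁ : ∀ x ρ, InBlock L z x → InBlock L z (x + e ρ) → ‖(U₁ x ρ : R) - 1‖ ≤ ℓ.τ₁
  gradU₀ : ∀ μ x ρ, InBlock L z x → InBlock L z (x + e ρ) → InBlock L z (x + e μ) →
    InBlock L z (x + e μ + e ρ) → ‖(U₀ (x + e μ) ρ : R) - U₀ x ρ‖ ≤ ℓ.γU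
  gradU₁ : ∀ μ x ρ, InBlock L z x → InBlock L z (x + e ρ) → InBlock L z (x + e μ) →
    InBlock L z (x + e μ + e ρ) → ‖(U₁ (x + e μ) ρ : R) - U₁ x ρ‖ ≤ ℓ.γU₁
  nonneg : ℓ.Nonneg

/-- [folklore] Twelve raw block sups contain seven raw block sups (projection: the seven-letter hypothesis is WEAKER). -/
theorem RawSups.drop {U₀ U₁ : Cfg d R} {ℓ : Letters} (h : RawSups L z U₀ U₁ ℓ) : RawSups₇ L z U₀ U₁ ℓ.drop :=
  ⟨h.unit₀, h.unit₁, h.dev, h.curv₀, h.curv₁, h.bond₀, h.bond₁, h.gradU₀, h.gradU₁,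
    ⟨h.nonneg.hs, h.nonneg.hq₀, h.nonneg.hq₁, h.nonneg.hτ₀, h.nonneg.hτ₁, h.nonneg.hγU, h.nonneg.hγU₁⟩⟩

/-- **SEVEN RAW BLOCK SUPS GIVE TWELVE** [folklore]: `RawSups₇ L z U₀ U₁ ℓ ⟹ RawSups L z U₀ U₁ ℓ.lift` — the plain
plaquette gradients, bond second differences and plaquette second differences of the producer's hypotheses are
bounded by `4γU, 4γU₁, 2γU, 8γU, 8γU₁` (`plaqGrad_le_of_bondGrad`, `bondHess_le_of_bondGrad`,
`plaqHess_le_of_bondGrad`). -/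
theorem RawSups₇.lift {U₀ U₁ : Cfg d R} {ℓ : Letters₇} (h : RawSups₇ L z U₀ U₁ ℓ) : RawSups L z U₀ U₁ ℓ.lift where
  unit₀ := h.unit₀
  unit₁ := h.unit₁
  dev := h.dev
  curv₀ := h.curv₀
  curv₁ := h.curv₁
  bond₀ := h.bond₀
  bond₁ := h.bond₁
  gradU₀ := h.gradU₀
  gradU₁ := h.gradU₁
  gradP₀ := plaqGrad_le_of_bondGrad h.unit₀ h.gradU₀
  gradP₁ := plaqGrad_le_of_bondGrad h.unit₁ h.gradU₁
  hessU₀ := bondHess_le_of_bondGrad h.gradU₀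
  hessP₀ := plaqHess_le_of_bondGrad h.unit₀ h.gradU₀
  hessP₁ := plaqHess_le_of_bondGrad h.unit₁ h.gradU₁
  nonneg := h.nonneg.lift

end Reduction

/-! ### §6.2  [arith] The unit-weight rate needs the dictionary only at RATE exponent `0` (window exponent `β` free) -/

section IntegerRate

/-- [folklore] (arith) Reading (A)'s dictionary at exponent `β ≥ 0` implies it at exponent `0` (`θ^{2+β} ≤ θ²` for
`0 < θ ≤ 1`): at exponent `0` ALL TWELVE letters are at INTEGER rates (`θ`, `θ²`). -/
theorem DictA.exponent_zero {θ c β C : ℝ} {ℓ : Letters} (hθ : 0 < θ) (hθ1 : θ ≤ 1) (hβ0 : 0 ≤ β) (hc0 : 0 ≤ c)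
    (hD : DictA θ c β C ℓ) : DictA θ c 0 C ℓ := by
  have hr : θ ^ (2 + β) ≤ θ ^ ((2 : ℝ) + 0) := Real.rpow_le_rpow_of_exponent_ge hθ hθ1 (by linarith)
  have k : ∀ {x : ℝ}, x ≤ c * θ ^ (2 + β) → x ≤ c * θ ^ ((2 : ℝ) + 0) := fun h =>
    h.trans (mul_le_mul_of_nonneg_left hr hc0)
  exact ⟨hD.count, hD.dev, hD.curv₀, hD.curv₁, hD.bond₀, hD.bond₁, hD.gradU₀, hD.gradU₁, k hD.gradP₀, k hD.gradP₁,
    k hD.hessU₀, k hD.hessP₀, k hD.hessP₁⟩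

/-- **THE UNIT-WEIGHT RATE UNDER THE EXPONENT-`0` DICTIONARY** [folklore] (arith): `0 < θ ≤ 1 ≤ c`, `0 ≤ β ≤ 1`,
`0 ≤ C`, nonnegative letters obeying `DictA θ c 0 C ℓ` (all twelve letters at integer rates), block side `L ≤ Λ`
with `1 ≤ Λ` ⟹ `N_{(1,1,1)}(telWin C L β ℓ) ≤ sockConst c Λ · θ²` — the Hölder exponent `β` of the WINDOW is
untouched; only the RATE dictionary is taken at exponent `0`: `T4CombSecondRaw.gradPoly_le_rateA` and
`secondDev_allRaw_le_rateA` BY NAME at `β = 0` (`G_raw ≤ 21c⁴θ²`, `σ ≤ 73(118c⁵)⁵θ²`), `L^{1−β} ≤ Λ`,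
`C·s ≤ c²θ²`, `C·s·γU ≤ c³θ⁴ ≤ c⁴θ²`.  §1's `winN_unit_telWin_le` is this ∘ `DictA.exponent_zero`. -/
theorem winN_unit_telWin_le_zero {L : ℕ} {θ c Λ β C : ℝ} {ℓ : Letters} (hθ : 0 < θ) (hθ1 : θ ≤ 1) (hβ0 : 0 ≤ β)
    (hβ1 : β ≤ 1) (hc1 : 1 ≤ c) (hC0 : 0 ≤ C) (hΛ : 1 ≤ Λ) (hL : (L : ℝ) ≤ Λ) (hn : ℓ.Nonneg)
    (hD : DictA θ c 0 C ℓ) : winN unitWin (telWin C L β ℓ) ≤ sockConst c Λ * θ ^ 2 := by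
  have hθ0 := hθ.le
  have hc0 : 0 ≤ c := by linarith
  have e20 : θ ^ ((2 : ℝ) + 0) = θ ^ 2 := by rw [add_zero, Real.rpow_two]
  have hK0 : (0 : ℝ) ≤ 73 * (118 * c ^ 5) ^ 5 := by positivity
  have hLβ : (L : ℝ) ^ (1 - β) ≤ Λ := rpow_one_sub_le_of_le hL hΛ hβ0 hβ1
  have hL0 : (0 : ℝ) ≤ (L : ℝ) ^ (1 - β) := Real.rpow_nonneg (Nat.cast_nonneg L) _
  have hc24 : c ^ 2 ≤ c ^ 4 := pow_le_pow_right₀ hc1 (by norm_num)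
  have hc34 : c ^ 3 ≤ c ^ 4 := pow_le_pow_right₀ hc1 (by norm_num)
  have hc40 : 0 ≤ c ^ 4 := by positivity
  have hθ2 : 0 ≤ θ ^ 2 := by positivity
  have hS4 : 22 * c ^ 4 ≤ sockConst c Λ := by
    unfold sockConst; nlinarith [mul_nonneg (zero_le_one.trans hΛ) hK0]
  have hG := gradPoly_le_rateA (β := 0) hθ hθ1 le_rfl hc1 hC0 hn.hs hn.hq₀ hn.hq₁ hn.hτ₀ hn.hτ₁ hn.hγU hn.hγ₀
    hn.hγ₁ hD.count hD.dev hD.curv₀ hD.curv₁ hD.bond₀ hD.bond₁ hD.gradU₀ hD.gradP₀ hD.gradP₁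
  have hσ := secondDev_allRaw_le_rateA (β := 0) hθ hθ1 le_rfl zero_le_one hc1 hC0 hn.hs hn.hq₀ hn.hq₁ hn.hτ₀
    hn.hτ₁ hn.hγU hn.hγU₁ hn.hγ₀ hn.hγ₁ hn.hγγU hn.hγγP hn.hγγ₁ hD.count hD.dev hD.curv₀ hD.curv₁ hD.bond₀
    hD.bond₁ hD.gradU₀ hD.gradU₁ hD.gradP₀ hD.gradP₁ hD.hessU₀ hD.hessP₀ hD.hessP₁
  rw [e20] at hσ
  rw [winN_unitWin_le_iff]
  refine ⟨?_, ?_, ?_⟩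
  · show C * ℓ.s ≤ sockConst c Λ * θ ^ 2
    have h : C * ℓ.s ≤ c * (c * θ ^ 2) := mul_le_mul hD.count hD.dev hn.hs hc0
    calc C * ℓ.s ≤ c ^ 2 * θ ^ 2 := h.trans_eq (by ring)
      _ ≤ sockConst c Λ * θ ^ 2 := mul_le_mul_of_nonneg_right (by linarith) hθ2
  · have h : C * ℓ.s * ℓ.γU ≤ c * (c * θ ^ 2) * (c * θ ^ 2) :=
      mul_le_mul (mul_le_mul hD.count hD.dev hn.hs hc0) hD.gradU₀ hn.hγU (by positivity)
    have h' : c * (c * θ ^ 2) * (c * θ ^ 2) ≤ c ^ 4 * θ ^ 2 := by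
      have hθ4 : θ ^ 2 * θ ^ 2 ≤ θ ^ 2 := by nlinarith [pow_le_one₀ hθ0 hθ1 (n := 2)]
      nlinarith
    have h2 : (telWin C L β ℓ).grad ≤ 22 * c ^ 4 * θ ^ 2 := by
      show gradPoly C ℓ.s ℓ.q₀ ℓ.q₁ ℓ.τ₀ ℓ.τ₁ ℓ.γU ℓ.γ₀ ℓ.γ₁ + C * ℓ.s * ℓ.γU ≤ 22 * c ^ 4 * θ ^ 2
      linarith
    exact h2.trans (mul_le_mul_of_nonneg_right hS4 hθ2)
  · have h3 : (telWin C L β ℓ).hol ≤ (L : ℝ) ^ (1 - β) * (73 * (118 * c ^ 5) ^ 5 * θ ^ 2) :=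
      mul_le_mul_of_nonneg_left hσ hL0
    refine h3.trans ?_
    have hsplit : sockConst c Λ * θ ^ 2 = 22 * c ^ 4 * θ ^ 2 + Λ * (73 * (118 * c ^ 5) ^ 5 * θ ^ 2) := by
      unfold sockConst; ring
    rw [hsplit]
    have h4 : (L : ℝ) ^ (1 - β) * (73 * (118 * c ^ 5) ^ 5 * θ ^ 2) ≤ Λ * (73 * (118 * c ^ 5) ^ 5 * θ ^ 2) :=
      mul_le_mul_of_nonneg_right hLβ (by positivity)
    linarith [mul_nonneg (mul_nonneg (by norm_num : (0 : ℝ) ≤ 22) hc40) hθ2]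

/-- [folklore] (cell reading, NOT print) THE SEVEN-LETTER DICTIONARY at parameter `θ` with constant `c` and comb
count `C`: a constant count `C ≤ c`; `s, q₀, q₁, γU, γU₁ ≤ cθ²`; `τ₀, τ₁ ≤ cθ` — INTEGER rates only, NO Hölder
exponent, NO letter of order `≥ 2`.  Per-letter printed status: record `t4/T4-EST-OG1p-D3.md` §2 (not
re-adjudicated).  NOT asserted for Bałaban's configurations. -/
structure Dict₇ (θ c C : ℝ) (ℓ : Letters₇) : Prop where
  count : C ≤ c
  dev : ℓ.s ≤ c * θ ^ 2
  curv₀ : ℓ.q₀ ≤ c * θ ^ 2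
  curv₁ : ℓ.q₁ ≤ c * θ ^ 2
  bond₀ : ℓ.τ₀ ≤ c * θ
  bond₁ : ℓ.τ₁ ≤ c * θ
  gradU₀ : ℓ.γU ≤ c * θ ^ 2
  gradU₁ : ℓ.γU₁ ≤ c * θ ^ 2

/-- [folklore] The twelve-letter dictionary of §1 contains the seven-letter dictionary (projection: WEAKER). -/
theorem DictA.drop {θ c β C : ℝ} {ℓ : Letters} (h : DictA θ c β C ℓ) : Dict₇ θ c C ℓ.drop :=
  ⟨h.count, h.dev, h.curv₀, h.curv₁, h.bond₀, h.bond₁, h.gradU₀, h.gradU₁⟩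

/-- [folklore] (arith) The derived twelve letters of seven letters obeying `Dict₇ θ c C ℓ` obey the exponent-`0`
dictionary with constant `8c` (`4γU ≤ 4cθ²`, `2γU ≤ 2cθ²`, `8γU ≤ 8cθ²`). -/
theorem Dict₇.lift {θ c C : ℝ} {ℓ : Letters₇} (hθ : 0 ≤ θ) (hc : 0 ≤ c) (h : Dict₇ θ c C ℓ) :
    DictA θ (8 * c) 0 C ℓ.lift := by
  have e20 : θ ^ ((2 : ℝ) + 0) = θ ^ 2 := by rw [add_zero, Real.rpow_two]
  have h2 : 0 ≤ c * θ ^ 2 := by positivity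
  have h1 : 0 ≤ c * θ := by positivity
  have k2 : ∀ {x : ℝ}, x ≤ c * θ ^ 2 → x ≤ 8 * c * θ ^ 2 := fun hx => by nlinarith
  have k1 : ∀ {x : ℝ}, x ≤ c * θ → x ≤ 8 * c * θ := fun hx => by nlinarith
  have kr : ∀ {x : ℝ} (m : ℝ), 0 ≤ m → m ≤ 8 → x ≤ c * θ ^ 2 → m * x ≤ 8 * c * θ ^ ((2 : ℝ) + 0) := by
    intro x m hm0 hm8 hx
    rw [e20]
    nlinarith [mul_le_mul_of_nonneg_left hx hm0, mul_le_mul_of_nonneg_right hm8 h2]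
  exact ⟨h.count.trans (by linarith), k2 h.dev, k2 h.curv₀, k2 h.curv₁, k1 h.bond₀, k1 h.bond₁, k2 h.gradU₀,
    k2 h.gradU₁, kr 4 (by norm_num) (by norm_num) h.gradU₀, kr 4 (by norm_num) (by norm_num) h.gradU₁,
    kr 2 (by norm_num) (by norm_num) h.gradU₀, kr 8 (by norm_num) (by norm_num) h.gradU₀,
    kr 8 (by norm_num) (by norm_num) h.gradU₁⟩

/-- **THE UNIT-WEIGHT RATE FROM SEVEN LETTERS** [folklore] (arith): `0 < θ ≤ 1 ≤ c`, `0 ≤ β ≤ 1`, `0 ≤ C`,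
nonnegative seven letters obeying `Dict₇ θ c C ℓ`, `L ≤ Λ`, `1 ≤ Λ` ⟹
`N_{(1,1,1)}(telWin C L β ℓ.lift) ≤ sockConst (8c) Λ · θ²`.  Constants not optimised. -/
theorem winN_unit_telWin₇_le {L : ℕ} {θ c Λ β C : ℝ} {ℓ : Letters₇} (hθ : 0 < θ) (hθ1 : θ ≤ 1) (hβ0 : 0 ≤ β)
    (hβ1 : β ≤ 1) (hc1 : 1 ≤ c) (hC0 : 0 ≤ C) (hΛ : 1 ≤ Λ) (hL : (L : ℝ) ≤ Λ) (hn : ℓ.Nonneg)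
    (hD : Dict₇ θ c C ℓ) : winN unitWin (telWin C L β ℓ.lift) ≤ sockConst (8 * c) Λ * θ ^ 2 :=
  winN_unit_telWin_le_zero hθ hθ1 hβ0 hβ1 (by linarith) hC0 hΛ hL hn.lift (hD.lift hθ.le (by linarith))

end IntegerRate

/-! ### §6.3  [arith] The seven-letter dictionary with the small-field parameter `ε` -/

section SevenEps

variable {ε : ℝ}

/-- [folklore] (cell reading, NOT print) THE SEVEN-LETTER DICTIONARY WITH THE SMALL-FIELD PARAMETER `ε`: `C ≤ c` and
the seven letters `≤ ε·`(the bounds of `Dict₇`).  `Dict₇E θ 1 c C ℓ ↔ Dict₇ θ c C ℓ`.  NOT asserted for Bałaban's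
configurations. -/
structure Dict₇E (θ ε c C : ℝ) (ℓ : Letters₇) : Prop where
  count : C ≤ c
  dev : ℓ.s ≤ ε * (c * θ ^ 2)
  curv₀ : ℓ.q₀ ≤ ε * (c * θ ^ 2)
  curv₁ : ℓ.q₁ ≤ ε * (c * θ ^ 2)
  bond₀ : ℓ.τ₀ ≤ ε * (c * θ)
  bond₁ : ℓ.τ₁ ≤ ε * (c * θ)
  gradU₀ : ℓ.γU ≤ ε * (c * θ ^ 2)
  gradU₁ : ℓ.γU₁ ≤ ε * (c * θ ^ 2)

/-- [folklore] At `ε = 1` the seven-letter `ε`-dictionary is the seven-letter dictionary. -/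
theorem dict₇E_one_iff {θ c C : ℝ} {ℓ : Letters₇} : Dict₇E θ 1 c C ℓ ↔ Dict₇ θ c C ℓ := by
  constructor
  · rintro ⟨h0, h1, h2, h3, h4, h5, h6, h7⟩
    exact ⟨h0, by simpa using h1, by simpa using h2, by simpa using h3, by simpa using h4, by simpa using h5,
      by simpa using h6, by simpa using h7⟩
  · rintro ⟨h0, h1, h2, h3, h4, h5, h6, h7⟩
    exact ⟨h0, by simpa using h1, by simpa using h2, by simpa using h3, by simpa using h4, by simpa using h5,
      by simpa using h6, by simpa using h7⟩

/-- [folklore] The twelve-letter `ε`-dictionary of §5 contains the seven-letter one (projection: WEAKER). -/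
theorem DictE.drop {θ c β C : ℝ} {ℓ : Letters} (h : DictE θ ε c β C ℓ) : Dict₇E θ ε c C ℓ.drop :=
  ⟨h.count, h.dev, h.curv₀, h.curv₁, h.bond₀, h.bond₁, h.gradU₀, h.gradU₁⟩

/-- [folklore] The seven letters scaled by `ε`. -/
def Letters₇.scale (ε : ℝ) (ℓ : Letters₇) : Letters₇ :=
  ⟨ε * ℓ.s, ε * ℓ.q₀, ε * ℓ.q₁, ε * ℓ.τ₀, ε * ℓ.τ₁, ε * ℓ.γU, ε * ℓ.γU₁⟩

/-- [folklore] Scaled nonnegative seven letters are nonnegative (`0 ≤ ε`). -/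
theorem Letters₇.Nonneg.scale {ℓ : Letters₇} (hn : ℓ.Nonneg) (hε0 : 0 ≤ ε) : (ℓ.scale ε).Nonneg :=
  ⟨mul_nonneg hε0 hn.hs, mul_nonneg hε0 hn.hq₀, mul_nonneg hε0 hn.hq₁, mul_nonneg hε0 hn.hτ₀,
    mul_nonneg hε0 hn.hτ₁, mul_nonneg hε0 hn.hγU, mul_nonneg hε0 hn.hγU₁⟩

/-- [folklore] Deriving twelve letters commutes with scaling (the derivation is linear). -/
theorem Letters₇.lift_scale (ε : ℝ) (ℓ : Letters₇) : (ℓ.scale ε).lift = ℓ.lift.scale ε := by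
  ext <;> simp only [Letters₇.lift, Letters₇.scale, Letters.scale] <;> ring

/-- [folklore] (arith) Under the seven-letter `ε`-dictionary the rescaled letters `ε⁻¹·ℓ` obey the seven-letter
dictionary and `ℓ = ε·(ε⁻¹·ℓ)` (`0 < ε`). -/
theorem dict₇_scale_inv {θ c C : ℝ} {ℓ : Letters₇} (hε : 0 < ε) (hD : Dict₇E θ ε c C ℓ) :
    Dict₇ θ c C (ℓ.scale ε⁻¹) ∧ (ℓ.scale ε⁻¹).scale ε = ℓ := by
  have hk : ∀ {x y : ℝ}, x ≤ ε * y → ε⁻¹ * x ≤ y := fun {x y} h =>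
    (mul_le_mul_of_nonneg_left h (inv_nonneg.2 hε.le)).trans_eq (inv_mul_cancel_left₀ hε.ne' y)
  have he : ∀ x : ℝ, ε * (ε⁻¹ * x) = x := fun x => mul_inv_cancel_left₀ hε.ne' x
  refine ⟨⟨hD.count, hk hD.dev, hk hD.curv₀, hk hD.curv₁, hk hD.bond₀, hk hD.bond₁, hk hD.gradU₀, hk hD.gradU₁⟩,
    ?_⟩
  ext <;> exact he _

/-- **THE UNIT-WEIGHT RATE FROM SEVEN LETTERS WITH THE SMALL-FIELD PARAMETER** [folklore] (arith): `0 < ε ≤ 1`,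
`0 < θ ≤ 1 ≤ c`, `0 ≤ β ≤ 1`, `0 ≤ C`, nonnegative seven letters obeying `Dict₇E θ ε c C ℓ`, `L ≤ Λ`, `1 ≤ Λ` ⟹
`N_{(1,1,1)}(telWin C L β ℓ.lift) ≤ ε·sockConst (8c) Λ·θ²` (`winN_unit_telWin₇_le` for `ε⁻¹·ℓ`, then §5's
`telWin_scale_le` through `Letters₇.lift_scale`). -/
theorem winN_unit_telWin₇_le_eps {L : ℕ} {θ c Λ β C : ℝ} {ℓ : Letters₇} (hε : 0 < ε) (hε1 : ε ≤ 1) (hθ : 0 < θ)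
    (hθ1 : θ ≤ 1) (hβ0 : 0 ≤ β) (hβ1 : β ≤ 1) (hc1 : 1 ≤ c) (hC0 : 0 ≤ C) (hΛ : 1 ≤ Λ) (hL : (L : ℝ) ≤ Λ)
    (hn : ℓ.Nonneg) (hD : Dict₇E θ ε c C ℓ) :
    winN unitWin (telWin C L β ℓ.lift) ≤ ε * sockConst (8 * c) Λ * θ ^ 2 := by
  obtain ⟨hD', hℓ⟩ := dict₇_scale_inv hε hD
  have hn' : (ℓ.scale ε⁻¹).Nonneg := hn.scale (inv_nonneg.2 hε.le)
  obtain ⟨h1, h2, h3⟩ := (winN_unitWin_le_iff).1 (winN_unit_telWin₇_le hθ hθ1 hβ0 hβ1 hc1 hC0 hΛ hL hn' hD')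
  obtain ⟨e1, e2, e3⟩ := telWin_scale_le (L := L) (β := β) (ε := ε) hε.le hε1 hC0 hn'.lift
  rw [← Letters₇.lift_scale, hℓ] at e1 e2 e3
  rw [winN_unitWin_le_iff]
  refine ⟨e1.trans ?_, e2.trans ?_, e3.trans ?_⟩
  · exact (mul_le_mul_of_nonneg_left h1 hε.le).trans_eq (by ring)
  · exact (mul_le_mul_of_nonneg_left h2 hε.le).trans_eq (by ring)
  · exact (mul_le_mul_of_nonneg_left h3 hε.le).trans_eq (by ring)

end SevenEps

/-! ### §6.4  [folklore] The seven-letter producer and the sockets -/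

section SevenProducer

variable [NormOneClass R] {L : ℕ} {z : Site d}

/-- [folklore] THE PER-PAIR PRODUCER FROM SEVEN RAW SUPS: seven raw block sups + the seven-letter `ε`-dictionary at `θ`
(`0 < ε ≤ 1`, `0 < θ ≤ 1 ≤ c`, `0 ≤ β ≤ 1`, `0 ≤ (d−1)(L−1)`, `L ≤ Λ`, `1 ≤ Λ`) ⟹ SOME window data `b_w` of the
comb-gauge block deviation with `N_{(1,1,1)}(b_w) ≤ ε·sockConst (8c) Λ·θ²` (§2's `windowData_telWin` on the derived
twelve sups `RawSups₇.lift`, `winN_unit_telWin₇_le_eps`). -/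
theorem exists_windowData_unit₇_eps {U₀ U₁ : Cfg d R} {β θ ε c Λ : ℝ} {ℓ : Letters₇} (hε : 0 < ε) (hε1 : ε ≤ 1)
    (hθ : 0 < θ) (hθ1 : θ ≤ 1) (hβ0 : 0 ≤ β) (hβ1 : β ≤ 1) (hc1 : 1 ≤ c) (hΛ : 1 ≤ Λ) (hL : (L : ℝ) ≤ Λ)
    (hC0 : 0 ≤ ((d : ℝ) - 1) * ((L : ℝ) - 1)) (h : RawSups₇ L z U₀ U₁ ℓ)
    (hD : Dict₇E θ ε c (((d : ℝ) - 1) * ((L : ℝ) - 1)) ℓ) :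
    ∃ bw : Win, WindowData L z β (blockDev L z (combGauge U₀ U₁ z) U₀ U₁) bw ∧
      winN unitWin bw ≤ ε * sockConst (8 * c) Λ * θ ^ 2 :=
  ⟨_, windowData_telWin hβ1 hC0 h.lift, winN_unit_telWin₇_le_eps hε hε1 hθ hθ1 hβ0 hβ1 hc1 hC0 hΛ hL h.nonneg hD⟩

end SevenProducer

section SevenSocket

variable [NormOneClass R] [NormedAlgebra ℂ R] {F : Type*} [NormedAddCommGroup F] [NormedSpace ℂ F] [CompleteSpace F]
variable {B : Booking} {T : Trajectory B}

/-- **THE SEVEN-LETTER COMB-RAW FEED ⟹ `TransportsFrom`** [folklore] (= `T4TrajectoryComparison.transportsFrom_of_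
window` with §6's producer plugged into `hlin`; weights `(1,1,1)`, `c_δ = ε·sockConst (8c) Λ`, `ψ = ϑ²`).  As §5's
`transportsFrom_of_combRaw_eps` but the feed asks, per attaining pair, only for the SEVEN raw block sups
`RawSups₇ (Lg b k′) (zg b k′) U₀ U₁ ℓ` (unitary-like pair; gauge-fixed relative plaquette deviation, curvatures, bond
deviations, plain bond gradients) obeying the INTEGER-RATE dictionary `Dict₇E (ϑ^{k−k′}) ε c ((d−1)(Lg b k′−1)) ℓ`
— no plaquette gradient, no second difference, no Hölder-type rate; window hypothesis `ε·sockConst (8c) Λ ≤ w`.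
NOT asserted for the cell's terms: every input is a binder. -/
theorem transportsFrom_of_combRaw₇_eps {Gate : ℕ → Prop} {Fn : B.Birth → ℕ → Fld d R → F}
    {Lg : B.Birth → ℕ → ℕ} {zg : B.Birth → ℕ → Site d} {𝒦 : B.Birth → ℕ → Set (Fld d R)}
    {β : ℝ} {w r ε c Λ ϑ : ℝ}
    (hinv : ∀ b k', GaugeInvariant (BlockRel (Lg b k') (zg b k')) (Fn b k'))
    (hsl : ∀ b k', BirthSlice (Fn b k') (wMove (Lg b k') (zg b k') β) (wN (Lg b k') (zg b k') β unitWin) (𝒦 b k')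
      w r (T.gen b k'))
    (hr : 0 < r) (hε : 0 < ε) (hε1 : ε ≤ 1) (hβ0 : 0 ≤ β) (hβ1 : β ≤ 1) (hc1 : 1 ≤ c) (hΛ : 1 ≤ Λ) (hϑ : 0 < ϑ)
    (hϑ1 : ϑ ≤ 1) (hw : ε * sockConst (8 * c) Λ ≤ w) (hL : ∀ b k', (Lg b k' : ℝ) ≤ Λ)
    (hCnn : ∀ b k', 0 ≤ ((d : ℝ) - 1) * ((Lg b k' : ℝ) - 1))
    (hCc : ∀ b k', ((d : ℝ) - 1) * ((Lg b k' : ℝ) - 1) ≤ c)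
    (hfeed : ∀ (b : B.Birth) (k' k : ℕ), B.birthScale b ≤ k' → k' ≤ k → k ≤ B.K → RanBelow Gate k → ∀ ε' > 0,
      ∃ U₀ U₁ : Cfg d R, ∃ ℓ : Letters₇, val U₀ ∈ 𝒦 b k' ∧ RawSups₇ (Lg b k') (zg b k') U₀ U₁ ℓ ∧
        Dict₇E (ϑ ^ (k - k')) ε c (((d : ℝ) - 1) * ((Lg b k' : ℝ) - 1)) ℓ ∧
        T.lin b k' k ≤ ‖Fn b k' (val U₁) - Fn b k' (val U₀)‖ + ε') :
    T.TransportsFrom (4 * (ε * sockConst (8 * c) Λ) / r) (ϑ ^ 2) Gate := by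
  have hΛ0 : 0 ≤ Λ := zero_le_one.trans hΛ
  have hcδ : 0 ≤ ε * sockConst (8 * c) Λ := mul_nonneg hε.le (sockConst_nonneg (by linarith) hΛ0)
  refine transportsFrom_of_window hinv hsl unitWin_pos hr (pow_nonneg hϑ.le 2) (pow_le_one₀ hϑ.le hϑ1) hcδ hw ?_
  intro b k' k hbk' hk'k hk hran ε' hε'
  obtain ⟨U₀, U₁, ℓ, hU₀𝒦, hR, hD, hle⟩ := hfeed b k' k hbk' hk'k hk hran ε' hε'
  have hθ : 0 < ϑ ^ (k - k') := pow_pos hϑ _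
  have hθ1 : ϑ ^ (k - k') ≤ 1 := pow_le_one₀ hϑ.le hϑ1
  obtain ⟨bw, hW, hbw⟩ := exists_windowData_unit₇_eps hε hε1 hθ hθ1 hβ0 hβ1 hc1 hΛ (hL b k') (hCnn b k') hR
    ⟨(hCc b k'), hD.dev, hD.curv₀, hD.curv₁, hD.bond₀, hD.bond₁, hD.gradU₀, hD.gradU₁⟩
  refine ⟨U₀, U₁, combGauge U₀ U₁ (zg b k'), bw, hU₀𝒦, unitaryLike_combGauge hR.unit₀ hR.unit₁ _, hW, ?_, hle⟩
  calc winN unitWin bw ≤ ε * sockConst (8 * c) Λ * (ϑ ^ (k - k')) ^ 2 := hbw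
    _ = ε * sockConst (8 * c) Λ * (ϑ ^ 2) ^ (k - k') := by rw [← pow_mul, ← pow_mul, Nat.mul_comm]

/-- **END TO END WITH THE SEVEN-LETTER COMB-RAW `ε`-FEED (strict product, bounded weights — K-UNIFORM)** [folklore]
(= §5's `latticeTrajectory_budget_combRaw_eps_strict` with the seven-letter feed: `transportsFrom_of_combRaw₇_eps`
under the history of the returned gate `(TOB-k) ∧ H`, then `T4TrajectoryComparison.Trajectory.sizeBound_cubeBudget_
of_trajectory_strict` BY NAME; any `C ≥ 4·(ε·sockConst (8c) Λ)/r`).  NOT asserted for the cell's terms. -/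
theorem latticeTrajectory_budget_combRaw₇_eps_strict {Fn : B.Birth → ℕ → Fld d R → F}
    {Lg : B.Birth → ℕ → ℕ} {zg : B.Birth → ℕ → Site d} {𝒦 : B.Birth → ℕ → Set (Fld d R)}
    {β : ℝ} {w r ε c Λ ϑ : ℝ} {N : ℕ → ℕ → ℝ} {wt : ℕ → ℝ} {N₀ Λc wbar C cR Ahat τ r' : ℝ} {H : ℕ → Prop}
    (hinv : ∀ b k', GaugeInvariant (BlockRel (Lg b k') (zg b k')) (Fn b k'))
    (hsl : ∀ b k', BirthSlice (Fn b k') (wMove (Lg b k') (zg b k') β) (wN (Lg b k') (zg b k') β unitWin) (𝒦 b k')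
      w r (T.gen b k'))
    (hr : 0 < r) (hε : 0 < ε) (hε1 : ε ≤ 1) (hβ0 : 0 ≤ β) (hβ1 : β ≤ 1) (hc1 : 1 ≤ c) (hΛ : 1 ≤ Λ) (hϑ : 0 < ϑ)
    (hϑ1 : ϑ ≤ 1) (hww : ε * sockConst (8 * c) Λ ≤ w) (hL : ∀ b k', (Lg b k' : ℝ) ≤ Λ)
    (hCnn : ∀ b k', 0 ≤ ((d : ℝ) - 1) * ((Lg b k' : ℝ) - 1))
    (hCc : ∀ b k', ((d : ℝ) - 1) * ((Lg b k' : ℝ) - 1) ≤ c) (hCle : 4 * (ε * sockConst (8 * c) Λ) / r ≤ C)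
    (hfeed : ∀ (b : B.Birth) (k' k : ℕ), B.birthScale b ≤ k' → k' ≤ k → k ≤ B.K →
      RanBelow (fun i => CubeBudgetAt B wt ((N₀ * (C * Ahat)) * wbar * (1 - r')⁻¹) i ∧ H i) k → ∀ ε' > 0,
      ∃ U₀ U₁ : Cfg d R, ∃ ℓ : Letters₇, val U₀ ∈ 𝒦 b k' ∧ RawSups₇ (Lg b k') (zg b k') U₀ U₁ ℓ ∧
        Dict₇E (ϑ ^ (k - k')) ε c (((d : ℝ) - 1) * ((Lg b k' : ℝ) - 1)) ℓ ∧
        T.lin b k' k ≤ ‖Fn b k' (val U₁) - Fn b k' (val U₀)‖ + ε')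
    (hw : ∀ j, j ≤ B.K → 0 ≤ wt j) (hwb : ∀ j, j ≤ B.K → wt j ≤ wbar) (hN : B.PositionalCount N)
    (hNle : ∀ j k, j ≤ k → k ≤ B.K → N j k ≤ N₀ * Λc ^ (k - j)) (hN₀ : 0 ≤ N₀) (hΛc : 0 ≤ Λc)
    (hcR : 0 ≤ cR) (hAhat : 0 ≤ Ahat) (hτ0 : 0 ≤ τ) (hτ1 : τ ≤ 1)
    (hprod : Λc * (ϑ ^ 2 + C * cR) * τ ≤ r') (hr'1 : r' < 1) (h0 : T.BirthGen Ahat τ)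
    (hreg : T.RegeneratesFrom cR (fun k => CubeBudgetAt B wt ((N₀ * (C * Ahat)) * wbar * (1 - r')⁻¹) k ∧ H k))
    (hH : GateOfSizes B (twoRate B.K (C * Ahat) (ϑ ^ 2 + C * cR) τ) H) :
    B.SizeBound (twoRate B.K (C * Ahat) (ϑ ^ 2 + C * cR) τ) ∧
      B.CubeBudget wt ((N₀ * (C * Ahat)) * wbar * (1 - r')⁻¹) ∧ ∀ k, k ≤ B.K → H k := by
  have hΛ0 : 0 ≤ Λ := zero_le_one.trans hΛ
  have hψ : (0 : ℝ) ≤ ϑ ^ 2 := pow_nonneg hϑ.le 2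
  have hC0 : 0 ≤ 4 * (ε * sockConst (8 * c) Λ) / r :=
    div_nonneg (mul_nonneg (by norm_num) (mul_nonneg hε.le (sockConst_nonneg (by linarith) hΛ0))) hr.le
  have hCC : 0 ≤ C := hC0.trans hCle
  have htr := (transportsFrom_of_combRaw₇_eps hinv hsl hr hε hε1 hβ0 hβ1 hc1 hΛ hϑ hϑ1 hww hL hCnn hCc
    hfeed).mono hCle hψ le_rfl hCC
  exact Trajectory.sizeBound_cubeBudget_of_trajectory_strict hw hwb hN hNle hN₀ hΛc hCC hψ hcR hAhat hτ0 hτ1 hprod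
    hr'1 h0 htr hreg hH

end SevenSocket

/-! ### §6.5  [folklore] Non-vacuity of the seven-letter feed -/

section SevenWitness

/-- [folklore] The zero seven letters. -/
def Letters₇.zero : Letters₇ := ⟨0, 0, 0, 0, 0, 0, 0⟩

/-- [folklore] The zero seven letters are nonnegative. -/
theorem Letters₇.zero_nonneg : Letters₇.zero.Nonneg := ⟨le_rfl, le_rfl, le_rfl, le_rfl, le_rfl, le_rfl, le_rfl⟩

/-- [folklore] The zero seven letters obey the `ε`-dictionary for any `0 ≤ ε`, `0 ≤ θ`, `0 ≤ c`, `C ≤ c`. -/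
theorem dict₇E_zero {θ ε c C : ℝ} (hε : 0 ≤ ε) (hθ : 0 ≤ θ) (hc : 0 ≤ c) (hC : C ≤ c) :
    Dict₇E θ ε c C Letters₇.zero := by
  have h2 : (0 : ℝ) ≤ ε * (c * θ ^ 2) := by positivity
  have h1 : (0 : ℝ) ≤ ε * (c * θ) := by positivity
  exact ⟨hC, h2, h2, h2, h1, h1, h2, h2⟩

/-- [folklore] NON-VACUITY OF THE SEVEN RAW SUPS: the flat pair `U₀ = U₁ ≡ 1` over `ℝ` has all seven letters `0`
(§4's `rawSups_flat`, projected). -/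
theorem rawSups₇_flat (d L : ℕ) (z : Site d) :
    RawSups₇ (R := ℝ) L z (fun _ _ => (1 : ℝˣ)) (fun _ _ => 1) Letters₇.zero :=
  (rawSups_flat d L z).drop

/-- [folklore] Hence the flat pair has window data of its (trivial) comb-gauge deviation inside the unit-weight window
at the rate `ε·sockConst (8c) Λ·θ²` for every `0 < ε ≤ 1`, `0 < θ ≤ 1 ≤ c`, `0 ≤ β ≤ 1`, `L ≤ Λ`,
`0 ≤ (d−1)(L−1) ≤ c` — the per-pair content of the seven-letter feed is jointly satisfiable. -/
example (d L : ℕ) (z : Site d) {β θ ε c Λ : ℝ} (hε : 0 < ε) (hε1 : ε ≤ 1) (hθ : 0 < θ) (hθ1 : θ ≤ 1)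
    (hβ0 : 0 ≤ β) (hβ1 : β ≤ 1) (hc1 : 1 ≤ c) (hΛ : 1 ≤ Λ) (hL : (L : ℝ) ≤ Λ)
    (hC0 : 0 ≤ ((d : ℝ) - 1) * ((L : ℝ) - 1)) (hC : ((d : ℝ) - 1) * ((L : ℝ) - 1) ≤ c) :
    ∃ bw : Win, WindowData L z β (blockDev L z (combGauge (fun _ _ => (1 : ℝˣ)) (fun _ _ => 1) z)
      (fun _ _ => (1 : ℝˣ)) (fun _ _ => 1)) bw ∧ winN unitWin bw ≤ ε * sockConst (8 * c) Λ * θ ^ 2 :=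
  exists_windowData_unit₇_eps hε hε1 hθ hθ1 hβ0 hβ1 hc1 hΛ hL hC0 (rawSups₇_flat d L z)
    (dict₇E_zero hε.le hθ.le (zero_le_one.trans hc1) hC)

/-- [folklore] THE TWELVE-LETTER FEEDS OF §3/§5 IMPLY THE SEVEN-LETTER FEED's per-pair content (projections
`RawSups.drop`, `DictE.drop`): the seven-letter socket asks LESS of each attaining pair (at the price of the constant
`sockConst (8c) Λ` for `sockConst c Λ`). -/
example [NormOneClass R] {L : ℕ} {z : Site d} {U₀ U₁ : Cfg d R} {θ ε c β C : ℝ} {ℓ : Letters}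
    (h : RawSups L z U₀ U₁ ℓ) (hD : DictE θ ε c β C ℓ) : RawSups₇ L z U₀ U₁ ℓ.drop ∧ Dict₇E θ ε c C ℓ.drop :=
  ⟨h.drop, hD.drop⟩

end SevenWitness

end Literature.MathematicalPhysics.QuantumFieldTheory.Balaban1983to89.T4CombWindowSocket
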